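import Mathlib
import HarnessLib
import Literature.Probability.MarkovChains.SpectralGapVariational

/-!
# Poincaré constants of decomposable Markov chains (Jerrum–Son–Tetali–Vigoda, Ann. Appl. Probab.
# 14 (2004), Thm 1 and Cor 3): the projection chain / restriction chains decomposition bound

HONEST FRAMING: exact (Metropolis-corrected) sampling algorithms for lattice gauge theory; figures
of merit are autocorrelation/cost numbers at stated couplings and volumes; no continuum-physics claim.

Conventions of `MetropolisHastings.lean` / `TotalVariation.lean` / `PeskunOrdering.lean` /
`SpectralGapVariational.lean`: finite state space `X` (the paper's `Ω`), ROW kernel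
`P : Matrix X X ℝ`, `IsRowStochastic`, `IsStationary`, `DetailedBalance`, `lawMean μ f = E_μ f`,
`lawVariance μ f = Var_μ f`, `dirichletForm π P f = 𝓔_π(f,f) = ½ Σ_{x,y} π(x)P(x,y)(f(x) − f(y))²`,
`spectralGapR π P = Gap_R` (the variational gap), `spectralGap π P = γ = 1 − λ₂` (reversible `P`).
Source READ for this file: M. Jerrum, J.-B. Son, P. Tetali, E. Vigoda, *Elementary bounds on
Poincaré and log-Sobolev constants for decomposable Markov chains*, Ann. Appl. Probab. 14 (2004)
1741–1765 [JerrumEtAl2004], §1–§2 (arXiv:math/0503537v1, pp. 2–9: the setting, Theorem 1 with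
its proof eqs. (4)–(17), Corollaries 2 and 3).  Everything below is PROVED (finite sums;
0 named facts).

All declarations live in the sub-namespace `Literature.Probability.MarkovChains.Decomposition`
(the decomposition's own vocabulary: `blockMass`, `blockLaw`, … would otherwise collide with the
block vocabulary of `RandomScanGroupingCollapsing.lean`).

THE SETTING [cite: JerrumEtAl2004, §2 "Poincaré constant via decomposition"].  A partition
`Ω = Ω_0 ∪ ⋯ ∪ Ω_{m−1}` of the state space into disjoint blocks is presented by its block map
`blk : X → I` (`Ω_i = {x : blk x = i}`, the fibres; `I` finite plays `[m]`).  For a weight `π` and a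
kernel `P`:
* `block blk i = Ω_i`, `blockMass π blk i = π̄(i) := Σ_{x ∈ Ω_i} π(x)`;
* `blockFlow π P blk i j = Σ_{x ∈ Ω_i, y ∈ Ω_j} π(x)P(x,y)` (`= π̄(i)P̄(i,j)`) and the **projection
  chain** `projectionChain π P blk = P̄`, `P̄(i,j) := π̄(i)⁻¹ Σ_{x ∈ Ω_i, y ∈ Ω_j} π(x)P(x,y)`;
* `blockLaw π blk i = π_i`, `π_i(x) := π(x)/π̄(i)` on `Ω_i` (and `0` off `Ω_i`: the law `π_i` is
  carried as a law on `X` supported on its block), `blockAvg π blk f i = E_{π_i} f`;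
* the **restriction chains** `restrictionChain P blk`: `P_i(x,y) = P(x,y)` for `x ≠ y` in `Ω_i` and
  `P_i(x,x) = 1 − Σ_{z ∈ Ω_i ∖ {x}} P(x,z)` — all `m` of them at once, as the one block-diagonal
  kernel on `X` that agrees with `P_i` on `Ω_i × Ω_i` and never leaves a block (so
  `𝓔_{π_i}(f,f) = dirichletForm (blockLaw π blk i) (restrictionChain P blk) f`, the values of `f`
  off `Ω_i` being invisible to `π_i`);
* `escapeProb P blk x = Σ_{y ∉ Ω_{blk x}} P(x,y)` and the parameter
  `escapeParameter P blk = γ := max_x escapeProb` of eq. (3) ("the probability of escape in one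
  step from the current block of the partition, maximized over all states");
* `crossTerm π P blk f i j = C_{ij} := Σ_{x ∈ Ω_i, y ∈ Ω_j} π(x)P(x,y)(f(x) − f(y))²` (eq. (5)).

Sanity of the definitions (as stated in §2): `projectionChain_isRowStochastic`,
`projectionChain_isStationary` (`π̄` is stationary for `P̄`), `projectionChain_detailedBalance`
("since the original Markov chain is time-reversible, so is the projection chain"),
`restrictionChain_isRowStochastic`, `restrictionChain_detailedBalance` /
`restrictionChain_detailedBalance_blockLaw` ("the restriction chain inherits time-reversibility
from the original chain, and so it has `π_i` as a stationary distribution":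
`restrictionChain_isStationary_blockLaw`).

THE PROOF, mirrored step by step [cite: JerrumEtAl2004, §2 proof of Theorem 1]:
* eq. (4) `lawVariance_decomposition`: `Var_π f = Σ_i π̄(i) Var_{π_i} f + Var_π̄(f̄)`, `f̄(i) = E_{π_i} f`
  (`lawMean_blockMass_blockAvg`: `E_π̄ f̄ = E_π f`);
* eq. (5) `dirichletForm_decomposition`: `𝓔_π(f,f) = Σ_i π̄(i)𝓔_{π_i}(f,f) + ½ Σ_{i ≠ j} C_{ij}`;
* `dirichletForm_projectionChain`: `𝓔_π̄(f̄,f̄) = ½ Σ_{i ≠ j} π̄(i)P̄(i,j)(f̄(i) − f̄(j))²`;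
* eqs. (7)–(13), per ordered pair of blocks, `blockFlow_mul_sq_sub_le`:
  `π̄(i)P̄(i,j)(a − b)² ≤ 3[Σ_{x∈Ω_i,y∈Ω_j} π(x)P(x,y)(f(x) − a)² + C_{ij} + Σ_{x∈Ω_i,y∈Ω_j} π(x)P(x,y)(f(y) − b)²]`
  for ANY constants `a, b` (the paper takes `a = E_{π_i} f`, `b = E_{π_j} f`; the three summands are
  its `Δ₁, Δ₂, Δ₃` contributions, each bounded by Cauchy–Schwarz for the joint law
  `π(x)P(x,y)/π̄(i)P̄(i,j)` on `Ω_i × Ω_j` with marginals `π̂ʲᵢ`, `π̂ⁱⱼ`, eqs. (8)–(12));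
* eqs. (13)–(15) `sum_escape_term_le` (the `Δ₁` sum is `≤ γ Σ_i π̄(i)Var_{π_i} f`, by the definition
  of `γ`) and its time-reversed twin `sum_entry_term_le` (the `Δ₃` sum, "equal by
  time-reversibility" in the paper — here bounded directly using detailed balance);
* eqs. (16)–(17) and the comparison with (5): **THEOREM 1** `JerrumEtAl2004_thm_1`.

RESULTS:
* **THEOREM 1** `JerrumEtAl2004_thm_1` [cite: JerrumEtAl2004, §2 Theorem 1]: for a finite
  time-reversible chain decomposed as above, if the projection chain satisfies a Poincaré inequality
  `𝓔_π̄(g,g) ≥ λ̄ Var_π̄ g` and the restriction chains satisfy `𝓔_{π_i}(f,f) ≥ λ_min Var_{π_i} f`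
  (uniform constant), and `γ` bounds every escape probability, then
  **`𝓔_π(f,f) ≥ λ Var_π f` for all `f`, `λ := min{λ̄/3, λ̄λ_min/(3γ + λ̄)}`**; the printed form with
  `γ` = eq. (3) is `JerrumEtAl2004_thm_1_escapeParameter`.  Typed hypotheses are exactly what the
  proof uses: `π > 0` on a partition into nonempty blocks (`blk` surjective), `P ≥ 0` entrywise and
  `π`-reversible; row sums and `Σ π = 1` are not needed for the inequality.
* `JerrumEtAl2004_thm_1_spectralGapR` / `_spectralGap`: the same constant bounds the variational gap
  `Gap_R(P)` from below, and (Levin–Peres–Wilmer Lemma 13.7, `SpectralGapVariational.lean`) the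
  spectral gap `γ(P) = 1 − λ₂` of the reversible chain [cite: JerrumEtAl2004, §2 eq. (1)–(2) (a
  Poincaré constant is a lower bound on the spectral gap, "interpreting `ρ` there as the reciprocal of
  our `λ`")] [cite: LevinPeres2017, §13.2.1 Lemma 13.7, Remark 13.8].
* **COROLLARY 3** `JerrumEtAl2004_cor_3` [cite: JerrumEtAl2004, §2 Corollary 3]: if `γ̂ = 0`, i.e.
  the exit mass `P(x, Ω_j)` does not depend on `x ∈ Ω_i` (eq. (18) with `ε = 0`: `π̂ʲᵢ = π_i`), then
  `Δ₁ = Δ₃ = 0`, "we save a factor 3", and **`λ := min{λ̄, λ_min}`** (the Boolean-cube case, where it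
  is exact).

NOT typed here: Corollary 2 (the `ε`-pointwise variant (18)–(22)), §3 Theorem 4 (the log-Sobolev
analogue) and the examples of §4.  Context (cell pub-lqcd): with the blocks = topological sectors
(or the levels of a tempering ladder) this is the LOWER-bound companion of the bottleneck upper
bound `Gap ≤ 2Φ⋆` (`BottleneckRatioSpectralGap.lean`): fast mixing inside each sector plus a fast
sector-to-sector projection chain plus small per-step escape `γ` of the order of `λ̄` gives a
spectral gap of the order of `min{λ̄, λ_min}` for the full chain.
-/

namespace Literature.Probability.MarkovChains.Decomposition

open Finset Matrix

variable {X I : Type*} [Fintype X] [Fintype I] [DecidableEq I]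

/-! ## Blocks, `π̄`, `P̄`, `π_i`, `γ`, `C_{ij}` -/

omit [Fintype I] in
/-- The block `Ω_i = {x : blk x = i}` of the partition presented by the block map `blk`.
[cite: JerrumEtAl2004, §2 ("Let `Ω = Ω_0 ∪ ⋯ ∪ Ω_{m−1}` be a decomposition of the state space into
`m` disjoint sets")] -/
def block (blk : X → I) (i : I) : Finset X := univ.filter fun x => blk x = i

omit [Fintype I] in
/-- `x ∈ Ω_i ↔ blk x = i`. [cite: JerrumEtAl2004, §2 (the partition `{Ω_i}`)] -/
@[simp] theorem mem_block {blk : X → I} {i : I} {x : X} : x ∈ block blk i ↔ blk x = i := by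
  simp [block]

/-- Summing over `Ω` is summing over the blocks and then inside each block.
[cite: JerrumEtAl2004, §2 (proof of Theorem 1, "partitioning the terms … according to … blocks of
the partition")] -/
theorem sum_eq_sum_block (blk : X → I) (g : X → ℝ) :
    ∑ x, g x = ∑ i, ∑ x ∈ block blk i, g x :=
  (Finset.sum_fiberwise univ blk g).symm

/-- `π̄(i) := Σ_{x ∈ Ω_i} π(x)`. [cite: JerrumEtAl2004, §2 (definition of `π̄ : [m] → [0,1]`)] -/
def blockMass (π : X → ℝ) (blk : X → I) (i : I) : ℝ := ∑ x ∈ block blk i, π x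

omit [Fintype I] in
/-- `π̄(i) > 0` for a positive `π` and a nonempty block. [cite: JerrumEtAl2004, §2 (the blocks of
the partition; `π̄(i)⁻¹` appears in the definition of `P̄`)] -/
theorem blockMass_pos {π : X → ℝ} (hπ : ∀ x, 0 < π x) {blk : X → I}
    (hblk : Function.Surjective blk) (i : I) : 0 < blockMass π blk i := by
  obtain ⟨x, hx⟩ := hblk i
  exact sum_pos (fun y _ => hπ y) ⟨x, mem_block.mpr hx⟩

omit [Fintype I] in
/-- `π̄(i) ≥ 0` for `π ≥ 0`. [cite: JerrumEtAl2004, §2 (definition of `π̄`)] -/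
theorem blockMass_nonneg {π : X → ℝ} (hπ : ∀ x, 0 ≤ π x) (blk : X → I) (i : I) :
    0 ≤ blockMass π blk i :=
  sum_nonneg fun x _ => hπ x

/-- `Σ_i π̄(i) = Σ_x π(x)` (`= 1`: `π̄` is a probability distribution on `[m]`).
[cite: JerrumEtAl2004, §2 (`π̄` "is to be considered as a probability distribution on `[m]`")] -/
theorem sum_blockMass (π : X → ℝ) (blk : X → I) : ∑ i, blockMass π blk i = ∑ x, π x :=
  (sum_eq_sum_block blk π).symm

/-- The flow between blocks, `Σ_{x ∈ Ω_i} Σ_{y ∈ Ω_j} π(x)P(x,y)` (`= π̄(i)P̄(i,j)`).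
[cite: JerrumEtAl2004, §2 (definition of `P̄(i,j) := π̄(i)⁻¹ Σ_{x∈Ω_i,y∈Ω_j} π(x)P(x,y)`)] -/
def blockFlow (π : X → ℝ) (P : Matrix X X ℝ) (blk : X → I) (i j : I) : ℝ :=
  ∑ x ∈ block blk i, ∑ y ∈ block blk j, π x * P x y

omit [Fintype I] in
/-- The flow is non-negative for `π ≥ 0`, `P ≥ 0`. [cite: JerrumEtAl2004, §2 (`P̄ : [m]² → [0,1]`)] -/
theorem blockFlow_nonneg {π : X → ℝ} (hπ : ∀ x, 0 ≤ π x) {P : Matrix X X ℝ}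
    (hP0 : ∀ x y, 0 ≤ P x y) (blk : X → I) (i j : I) : 0 ≤ blockFlow π P blk i j :=
  sum_nonneg fun x _ => sum_nonneg fun y _ => mul_nonneg (hπ x) (hP0 x y)

/-- **The projection chain** `P̄(i,j) := π̄(i)⁻¹ Σ_{x ∈ Ω_i, y ∈ Ω_j} π(x)P(x,y)` on `[m]`.
[cite: JerrumEtAl2004, §2 ("The Markov chain on state space `[m]` with transition probabilities `P̄`
is the projection chain induced by the partition `{Ω_i}`")] -/
noncomputable def projectionChain (π : X → ℝ) (P : Matrix X X ℝ) (blk : X → I) : Matrix I I ℝ :=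
  Matrix.of fun i j => blockFlow π P blk i j / blockMass π blk i

omit [Fintype I] in
/-- Entries of the projection chain. [cite: JerrumEtAl2004, §2 (definition of `P̄`)] -/
theorem projectionChain_apply (π : X → ℝ) (P : Matrix X X ℝ) (blk : X → I) (i j : I) :
    projectionChain π P blk i j = blockFlow π P blk i j / blockMass π blk i := rfl

/-- `π_i(x) := π(x)/π̄(i)` for `x ∈ Ω_i`, carried as a law on `X` supported on `Ω_i`.
[cite: JerrumEtAl2004, §2 ("`π_i : Ω_i → [0,1]` … where `π_i(x) = π(x)/π̄(i)`")] -/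
noncomputable def blockLaw (π : X → ℝ) (blk : X → I) (i : I) (x : X) : ℝ :=
  if blk x = i then π x / blockMass π blk i else 0

/-- The block averages `f̄(i) := E_{π_i} f`. [cite: JerrumEtAl2004, §2 (eq. (4) and "`f̄` as a
function on `[m]`"; the proof's `E_{π_i} f`)] -/
noncomputable def blockAvg (π : X → ℝ) (blk : X → I) (f : X → ℝ) (i : I) : ℝ :=
  lawMean (blockLaw π blk i) f

/-- The escape probability `Σ_{y ∈ Ω ∖ Ω_i} P(x,y)` from the block `Ω_i ∋ x`.
[cite: JerrumEtAl2004, §2 eq. (3) (the inner sum `Σ_{y ∈ Ω∖Ω_i} P(x,y)`)] -/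
def escapeProb (P : Matrix X X ℝ) (blk : X → I) (x : X) : ℝ :=
  ∑ y ∈ univ.filter (fun y => blk y ≠ blk x), P x y

/-- **`γ := max_{i ∈ [m]} max_{x ∈ Ω_i} Σ_{y ∈ Ω ∖ Ω_i} P(x,y)`** — "the probability of escape in one
step from the current block of the partition, maximized over all states" (junk value `0` on an
empty space). [cite: JerrumEtAl2004, §2 eq. (3)] -/
noncomputable def escapeParameter (P : Matrix X X ℝ) (blk : X → I) : ℝ :=
  ⨆ x, escapeProb P blk x

/-- `C_{ij} := Σ_{x ∈ Ω_i} Σ_{y ∈ Ω_j} π(x)P(x,y)(f(x) − f(y))²`. [cite: JerrumEtAl2004, §2 eq. (5)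
(definition of `C_{ij}`)] -/
def crossTerm (π : X → ℝ) (P : Matrix X X ℝ) (blk : X → I) (f : X → ℝ) (i j : I) : ℝ :=
  ∑ x ∈ block blk i, ∑ y ∈ block blk j, π x * P x y * (f x - f y) ^ 2

omit [Fintype I] in
/-- `C_{ij} ≥ 0` for `π ≥ 0`, `P ≥ 0`. [cite: JerrumEtAl2004, §2 eq. (5)] -/
theorem crossTerm_nonneg {π : X → ℝ} (hπ : ∀ x, 0 ≤ π x) {P : Matrix X X ℝ}
    (hP0 : ∀ x y, 0 ≤ P x y) (blk : X → I) (f : X → ℝ) (i j : I) :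
    0 ≤ crossTerm π P blk f i j :=
  sum_nonneg fun x _ => sum_nonneg fun y _ => mul_nonneg (mul_nonneg (hπ x) (hP0 x y)) (sq_nonneg _)

/-! ## `π_i`: integrals, mean, variance -/

omit [Fintype I] in
/-- `Σ_x π_i(x) g(x) = π̄(i)⁻¹ Σ_{x ∈ Ω_i} π(x) g(x)`. [cite: JerrumEtAl2004, §2 (`π_i(x) =
π(x)/π̄(i)` on `Ω_i`)] -/
theorem sum_blockLaw_mul (π : X → ℝ) (blk : X → I) (i : I) (g : X → ℝ) :
    ∑ x, blockLaw π blk i x * g x = (∑ x ∈ block blk i, π x * g x) / blockMass π blk i := by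
  rw [sum_div]
  unfold blockLaw block
  rw [sum_filter]
  refine sum_congr rfl fun x _ => ?_
  split_ifs <;> ring

omit [Fintype I] in
/-- `π_i` has total mass `1` (when `π̄(i) ≠ 0`). [cite: JerrumEtAl2004, §2 ("`π_i` is to be considered
as a probability distribution on `Ω_i`")] -/
theorem sum_blockLaw {π : X → ℝ} {blk : X → I} {i : I} (hM : blockMass π blk i ≠ 0) :
    ∑ x, blockLaw π blk i x = 1 := by
  have h := sum_blockLaw_mul π blk i fun _ => 1
  simp only [mul_one] at h
  rw [h]
  exact div_self hM

omit [Fintype I] in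
/-- `π_i ≥ 0` for `π ≥ 0`. [cite: JerrumEtAl2004, §2 (`π_i : Ω_i → [0,1]`)] -/
theorem blockLaw_nonneg {π : X → ℝ} (hπ : ∀ x, 0 ≤ π x) (blk : X → I) (i : I) (x : X) :
    0 ≤ blockLaw π blk i x := by
  unfold blockLaw
  split_ifs
  · exact div_nonneg (hπ x) (blockMass_nonneg hπ blk i)
  · exact le_rfl

omit [Fintype I] in
/-- `π_i` vanishes off `Ω_i`. [cite: JerrumEtAl2004, §2 (`π_i : Ω_i → [0,1]`)] -/
theorem blockLaw_of_ne {π : X → ℝ} {blk : X → I} {i : I} {x : X} (hx : blk x ≠ i) :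
    blockLaw π blk i x = 0 := by
  unfold blockLaw
  rw [if_neg hx]

omit [Fintype I] in
/-- `f̄(i) = E_{π_i} f = π̄(i)⁻¹ Σ_{x ∈ Ω_i} π(x)f(x)`. [cite: JerrumEtAl2004, §2 (the block averages
`E_{π_i} f` of eq. (4))] -/
theorem blockAvg_eq (π : X → ℝ) (blk : X → I) (f : X → ℝ) (i : I) :
    blockAvg π blk f i = (∑ x ∈ block blk i, π x * f x) / blockMass π blk i := by
  unfold blockAvg lawMean
  exact sum_blockLaw_mul π blk i f

/-- `E_π̄ f̄ = E_π f`: averaging the block averages against `π̄` recovers the mean.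
[cite: JerrumEtAl2004, §2 eq. (4) (its second term is the variance of `f̄` under `π̄`, whose mean is
`E_π f`)] -/
theorem lawMean_blockMass_blockAvg {π : X → ℝ} {blk : X → I} (hM : ∀ i, blockMass π blk i ≠ 0)
    (f : X → ℝ) : lawMean (blockMass π blk) (blockAvg π blk f) = lawMean π f := by
  unfold lawMean
  rw [sum_eq_sum_block blk]
  refine sum_congr rfl fun i _ => ?_
  rw [blockAvg_eq]
  exact mul_div_cancel₀ _ (hM i)

omit [Fintype I] in
/-- Within a block, `f − E_{π_i} f` integrates to zero against `π`:
`Σ_{x ∈ Ω_i} π(x)(f(x) − f̄(i)) = 0`. [cite: JerrumEtAl2004, §2 (proof of eq. (4), "simple algebraic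
manipulation")] -/
theorem sum_block_mul_sub_blockAvg {π : X → ℝ} {blk : X → I} {i : I}
    (hM : blockMass π blk i ≠ 0) (f : X → ℝ) :
    ∑ x ∈ block blk i, π x * (f x - blockAvg π blk f i) = 0 := by
  have h : ∑ x ∈ block blk i, π x * (f x - blockAvg π blk f i)
      = (∑ x ∈ block blk i, π x * f x) - blockMass π blk i * blockAvg π blk f i := by
    unfold blockMass
    rw [sum_mul, ← sum_sub_distrib]
    exact sum_congr rfl fun x _ => by ring
  rw [h, blockAvg_eq, mul_div_cancel₀ _ hM, sub_self]

omit [Fintype I] in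
/-- `π̄(i) Var_{π_i} f = Σ_{x ∈ Ω_i} π(x)(f(x) − f̄(i))²`. [cite: JerrumEtAl2004, §2 eq. (4) (the terms
`π̄(i)Var_{π_i} f`)] -/
theorem blockMass_mul_lawVariance_blockLaw {π : X → ℝ} {blk : X → I} {i : I}
    (hM : blockMass π blk i ≠ 0) (f : X → ℝ) :
    blockMass π blk i * lawVariance (blockLaw π blk i) f
      = ∑ x ∈ block blk i, π x * (f x - blockAvg π blk f i) ^ 2 := by
  unfold lawVariance
  rw [show lawMean (blockLaw π blk i) f = blockAvg π blk f i from rfl, sum_blockLaw_mul]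
  exact mul_div_cancel₀ _ hM

/-- **Eq. (4): the decomposition of the variance with respect to the partition**,
`Var_π f = Σ_i π̄(i) Var_{π_i} f + Σ_i π̄(i)(E_{π_i} f − E_π f)²`, the second sum being
`Var_π̄ f̄` — "the variance of `f` may be obtained by summing the variances within blocks of the
partition and the variance between blocks". [cite: JerrumEtAl2004, §2 eq. (4)] -/
theorem lawVariance_decomposition {π : X → ℝ} {blk : X → I} (hM : ∀ i, blockMass π blk i ≠ 0)
    (f : X → ℝ) :
    lawVariance π f = ∑ i, blockMass π blk i * lawVariance (blockLaw π blk i) f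
      + lawVariance (blockMass π blk) (blockAvg π blk f) := by
  set m := lawMean π f with hm
  have hmean : lawMean (blockMass π blk) (blockAvg π blk f) = m :=
    lawMean_blockMass_blockAvg hM f
  have key : ∀ i, ∑ x ∈ block blk i, π x * (f x - m) ^ 2 =
      blockMass π blk i * lawVariance (blockLaw π blk i) f
        + blockMass π blk i * (blockAvg π blk f i - m) ^ 2 := by
    intro i
    rw [blockMass_mul_lawVariance_blockLaw (hM i)]
    have h0 := sum_block_mul_sub_blockAvg (hM i) f
    have hx : ∀ x, π x * (f x - m) ^ 2 = π x * (f x - blockAvg π blk f i) ^ 2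
        + 2 * (blockAvg π blk f i - m) * (π x * (f x - blockAvg π blk f i))
        + (blockAvg π blk f i - m) ^ 2 * π x := fun x => by ring
    simp_rw [hx, sum_add_distrib, ← mul_sum, h0, mul_zero, add_zero]
    unfold blockMass
    ring
  calc lawVariance π f = ∑ i, ∑ x ∈ block blk i, π x * (f x - m) ^ 2 := by
        unfold lawVariance
        rw [← hm]
        exact sum_eq_sum_block blk _
    _ = ∑ i, (blockMass π blk i * lawVariance (blockLaw π blk i) f
          + blockMass π blk i * (blockAvg π blk f i - m) ^ 2) := sum_congr rfl fun i _ => key i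
    _ = _ := by
        rw [sum_add_distrib]
        congr 1
        unfold lawVariance
        rw [hmean]

/-! ## The projection chain: sanity (`π̄` stationary, reversibility inherited) -/

/-- `Σ_j π̄(i)P̄(i,j) = Σ_j F(i,j) = Σ_{x ∈ Ω_i} π(x) Σ_y P(x,y)`: the flows out of block `i` add up
to `π̄(i)` for a stochastic `P`. [cite: JerrumEtAl2004, §2 (the projection chain is a Markov chain on
`[m]`)] -/
theorem sum_blockFlow (π : X → ℝ) (P : Matrix X X ℝ) (blk : X → I) (i : I) :
    ∑ j, blockFlow π P blk i j = ∑ x ∈ block blk i, π x * ∑ y, P x y := by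
  unfold blockFlow
  rw [sum_comm]
  refine sum_congr rfl fun x _ => ?_
  rw [mul_sum, sum_eq_sum_block blk]

/-- The projection chain is a transition matrix (for a row-stochastic `P`, positive `π`, nonempty
blocks). [cite: JerrumEtAl2004, §2 ("The Markov chain on state space `[m]` with transition
probabilities `P̄`")] -/
theorem projectionChain_isRowStochastic {π : X → ℝ} (hπ : ∀ x, 0 < π x) {P : Matrix X X ℝ}
    (hP : IsRowStochastic P) {blk : X → I} (hblk : Function.Surjective blk) :
    IsRowStochastic (projectionChain π P blk) := by
  refine ⟨fun i j => ?_, fun i => ?_⟩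
  · rw [projectionChain_apply]
    exact div_nonneg (blockFlow_nonneg (fun x => (hπ x).le) hP.1 blk i j)
      (blockMass_nonneg (fun x => (hπ x).le) blk i)
  simp_rw [projectionChain_apply]
  rw [← sum_div, sum_blockFlow]
  have h : ∑ x ∈ block blk i, π x * ∑ y, P x y = blockMass π blk i := by
    unfold blockMass
    exact sum_congr rfl fun x _ => by rw [hP.2 x, mul_one]
  rw [h]
  exact div_self (blockMass_pos hπ hblk i).ne'

omit [Fintype I] in
/-- `π̄(i)P̄(i,j) = Σ_{x ∈ Ω_i, y ∈ Ω_j} π(x)P(x,y)`. [cite: JerrumEtAl2004, §2 (proof of Theorem 1,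
"`π(x)P(x,y)/π̄(i)P̄(i,j)` is a joint distribution on `Ω_i × Ω_j`")] -/
theorem blockMass_mul_projectionChain {π : X → ℝ} {blk : X → I} {i : I}
    (hM : blockMass π blk i ≠ 0) (P : Matrix X X ℝ) (j : I) :
    blockMass π blk i * projectionChain π P blk i j = blockFlow π P blk i j := by
  rw [projectionChain_apply]
  exact mul_div_cancel₀ _ hM

/-- **`π̄` is stationary for the projection chain** whenever `π` is stationary for `P`.
[cite: JerrumEtAl2004, §2 ("It is easy to check … that the projection chain has `π̄` as a stationary
distribution")] -/
theorem projectionChain_isStationary {π : X → ℝ} {P : Matrix X X ℝ} (hst : IsStationary π P)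
    {blk : X → I} (hM : ∀ i, blockMass π blk i ≠ 0) :
    IsStationary (blockMass π blk) (projectionChain π P blk) := by
  intro j
  simp_rw [blockMass_mul_projectionChain (hM _)]
  unfold blockFlow blockMass
  rw [← sum_eq_sum_block blk]
  rw [sum_comm]
  refine sum_congr rfl fun y _ => ?_
  exact hst y

omit [Fintype I] in
/-- **The projection chain inherits time-reversibility**: `π̄(i)P̄(i,j) = π̄(j)P̄(j,i)`.
[cite: JerrumEtAl2004, §2 ("Since the original Markov chain is time-reversible, so is the projection
chain")] -/
theorem projectionChain_detailedBalance {π : X → ℝ} {P : Matrix X X ℝ} (hDB : DetailedBalance π P)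
    {blk : X → I} (hM : ∀ i, blockMass π blk i ≠ 0) :
    DetailedBalance (blockMass π blk) (projectionChain π P blk) := by
  intro i j
  rw [blockMass_mul_projectionChain (hM i), blockMass_mul_projectionChain (hM j)]
  unfold blockFlow
  rw [sum_comm]
  exact sum_congr rfl fun y _ => sum_congr rfl fun x _ => hDB x y

/-- The Dirichlet form of the projection chain: `𝓔_π̄(g,g) = ½ Σ_i Σ_{j ≠ i} π̄(i)P̄(i,j)(g(i) − g(j))²`
(the diagonal terms vanish). [cite: JerrumEtAl2004, §2 eq. (7) (first inequality: the Poincaré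
inequality for the projection chain written with `½ Σ_{i≠j} π̄(i)P̄(i,j)(E_{π_i}f − E_{π_j}f)²`)] -/
theorem dirichletForm_projectionChain {π : X → ℝ} {blk : X → I} (hM : ∀ i, blockMass π blk i ≠ 0)
    (P : Matrix X X ℝ) (g : I → ℝ) :
    dirichletForm (blockMass π blk) (projectionChain π P blk) g
      = (1 / 2) * ∑ i, ∑ j ∈ univ.erase i, blockFlow π P blk i j * (g i - g j) ^ 2 := by
  unfold dirichletForm
  congr 1
  refine sum_congr rfl fun i _ => ?_
  rw [sum_erase_eq_sub (mem_univ i), sub_self, zero_pow two_ne_zero, mul_zero, sub_zero]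
  exact sum_congr rfl fun j _ => by rw [blockMass_mul_projectionChain (hM i)]

/-! ## The restriction chains: sanity (stochastic, reversibility inherited) -/

section Restriction

variable [DecidableEq X]

/-- **The restriction chains** `P_i(x,y) = P(x,y)` (`x ≠ y` in `Ω_i`),
`P_i(x,x) = 1 − Σ_{z ∈ Ω_i ∖ {x}} P(x,z)`, all blocks at once as one block-diagonal kernel on `Ω`
(zero between different blocks). [cite: JerrumEtAl2004, §2 ("For each `i ∈ [m]` the restriction
Markov chain on `Ω_i` has transition probabilities `P_i : Ω_i² → [0,1]` defined by …")] -/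
noncomputable def restrictionChain (P : Matrix X X ℝ) (blk : X → I) : Matrix X X ℝ :=
  Matrix.of fun x y => if blk y = blk x then
    (if y = x then 1 - ∑ z ∈ (block blk (blk x)).erase x, P x z else P x y) else 0

omit [Fintype I] in
/-- Entries of the restriction kernel. [cite: JerrumEtAl2004, §2 (definition of `P_i`)] -/
theorem restrictionChain_apply (P : Matrix X X ℝ) (blk : X → I) (x y : X) :
    restrictionChain P blk x y = if blk y = blk x then
      (if y = x then 1 - ∑ z ∈ (block blk (blk x)).erase x, P x z else P x y) else 0 := rfl

omit [Fintype I] in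
/-- Off the diagonal the restriction kernel is `P` inside a block and `0` across blocks.
[cite: JerrumEtAl2004, §2 (`P_i(x,y) = P(x,y)` if `x ≠ y`)] -/
theorem restrictionChain_apply_of_ne (P : Matrix X X ℝ) (blk : X → I) {x y : X} (hyx : y ≠ x) :
    restrictionChain P blk x y = if blk y = blk x then P x y else 0 := by
  rw [restrictionChain_apply, if_neg hyx]

omit [Fintype I] in
/-- The diagonal entry `P_i(x,x) = 1 − Σ_{z ∈ Ω_i ∖ {x}} P(x,z)`. [cite: JerrumEtAl2004, §2
(`P_i(x,x) = 1 − Σ_{z∈Ω_i∖{x}} P(x,z)`)] -/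
theorem restrictionChain_apply_self (P : Matrix X X ℝ) (blk : X → I) (x : X) :
    restrictionChain P blk x x = 1 - ∑ z ∈ (block blk (blk x)).erase x, P x z := by
  rw [restrictionChain_apply, if_pos rfl, if_pos rfl]

omit [Fintype I] in
/-- In a Dirichlet form only off-diagonal entries matter: `P_i(x,y)(f(x) − f(y))²` is
`P(x,y)(f(x) − f(y))²` inside a block and `0` across blocks. [cite: JerrumEtAl2004, §2 eq. (5) (the
terms `π̄(i)𝓔_{π_i}(f,f)`)] -/
theorem restrictionChain_mul_sq_sub (P : Matrix X X ℝ) (blk : X → I) (f : X → ℝ) (x y : X) :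
    restrictionChain P blk x y * (f x - f y) ^ 2
      = (if blk y = blk x then P x y else 0) * (f x - f y) ^ 2 := by
  by_cases hyx : y = x
  · subst hyx
    simp
  · rw [restrictionChain_apply_of_ne P blk hyx]

omit [Fintype I] in
/-- The restriction kernel is a transition matrix (for a row-stochastic `P`).
[cite: JerrumEtAl2004, §2 (`P_i : Ω_i² → [0,1]` are transition probabilities)] -/
theorem restrictionChain_isRowStochastic {P : Matrix X X ℝ} (hP : IsRowStochastic P)
    (blk : X → I) : IsRowStochastic (restrictionChain P blk) := by
  refine ⟨fun x y => ?_, fun x => ?_⟩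
  · by_cases hyx : y = x
    · subst hyx
      rw [restrictionChain_apply_self, sub_nonneg]
      exact (sum_le_sum_of_subset_of_nonneg (subset_univ _) fun z _ _ => hP.1 _ z).trans_eq (hP.2 _)
    · rw [restrictionChain_apply_of_ne P blk hyx]
      split_ifs
      · exact hP.1 x y
      · exact le_rfl
  · have hB : x ∈ block blk (blk x) := mem_block.mpr rfl
    have h1 : ∑ y, restrictionChain P blk x y = ∑ y ∈ block blk (blk x), restrictionChain P blk x y := by
      unfold block
      rw [sum_filter]
      refine sum_congr rfl fun y _ => ?_
      by_cases hb : blk y = blk x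
      · rw [if_pos hb]
      · rw [if_neg hb, restrictionChain_apply, if_neg hb]
    have h2 : ∑ y ∈ (block blk (blk x)).erase x, restrictionChain P blk x y
        = ∑ y ∈ (block blk (blk x)).erase x, P x y :=
      sum_congr rfl fun y hy => by
        rw [restrictionChain_apply_of_ne P blk (ne_of_mem_erase hy),
          if_pos (mem_block.mp (mem_of_mem_erase hy))]
    rw [h1, ← add_sum_erase _ (restrictionChain P blk x) hB, restrictionChain_apply_self, h2]
    ring

omit [Fintype I] in
/-- **The restriction chains inherit time-reversibility** (with respect to `π` itself: the
block-diagonal kernel is `π`-reversible). [cite: JerrumEtAl2004, §2 ("the restriction chain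
inherits time-reversibility from the original chain")] -/
theorem restrictionChain_detailedBalance {π : X → ℝ} {P : Matrix X X ℝ} (hDB : DetailedBalance π P)
    (blk : X → I) : DetailedBalance π (restrictionChain P blk) := by
  intro x y
  by_cases hyx : y = x
  · subst hyx
    rfl
  · rw [restrictionChain_apply_of_ne P blk hyx, restrictionChain_apply_of_ne P blk (Ne.symm hyx)]
    by_cases hb : blk y = blk x
    · rw [if_pos hb, if_pos hb.symm]
      exact hDB x y
    · rw [if_neg hb, if_neg (fun h => hb h.symm), mul_zero, mul_zero]

omit [Fintype I] in
/-- … hence with respect to each `π_i`: `π_i(x)P_i(x,y) = π_i(y)P_i(y,x)`.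
[cite: JerrumEtAl2004, §2 ("the restriction chain inherits time-reversibility from the original
chain, and so it has `π_i` … as a stationary distribution")] -/
theorem restrictionChain_detailedBalance_blockLaw {π : X → ℝ} {P : Matrix X X ℝ}
    (hDB : DetailedBalance π P) (blk : X → I) (i : I) :
    DetailedBalance (blockLaw π blk i) (restrictionChain P blk) := by
  intro x y
  by_cases hyx : y = x
  · subst hyx
    rfl
  · rw [restrictionChain_apply_of_ne P blk hyx, restrictionChain_apply_of_ne P blk (Ne.symm hyx)]
    by_cases hb : blk y = blk x
    · rw [if_pos hb, if_pos hb.symm]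
      unfold blockLaw
      rw [hb]
      split_ifs
      · rw [div_mul_eq_mul_div, div_mul_eq_mul_div, hDB x y]
      · rw [zero_mul, zero_mul]
    · rw [if_neg hb, if_neg (fun h => hb h.symm), mul_zero, mul_zero]

omit [Fintype I] in
/-- … and so `π_i` is stationary for the restriction chain. [cite: JerrumEtAl2004, §2 ("and so it
has `π_i : Ω_i → [0,1]` as a stationary distribution")] -/
theorem restrictionChain_isStationary_blockLaw {π : X → ℝ} {P : Matrix X X ℝ}
    (hP : IsRowStochastic P) (hDB : DetailedBalance π P) (blk : X → I) (i : I) :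
    IsStationary (blockLaw π blk i) (restrictionChain P blk) :=
  (restrictionChain_detailedBalance_blockLaw hDB blk i).isStationary
    (restrictionChain_isRowStochastic hP blk).2

/-! ## Eq. (5): the decomposition of the Dirichlet form -/

omit [DecidableEq X] in
/-- `𝓔_π(f,f) = ½ Σ_i Σ_j C_{ij}` — partition both summation variables by blocks.
[cite: JerrumEtAl2004, §2 eq. (5) ("partitioning the terms in the definition of `𝓔_π(f,f)` according
to whether `i` and `j` are in the same or in different blocks")] -/
theorem dirichletForm_eq_sum_crossTerm (π : X → ℝ) (P : Matrix X X ℝ) (blk : X → I) (f : X → ℝ) :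
    dirichletForm π P f = (1 / 2) * ∑ i, ∑ j, crossTerm π P blk f i j := by
  unfold dirichletForm crossTerm
  congr 1
  rw [sum_eq_sum_block blk]
  refine sum_congr rfl fun i _ => ?_
  calc ∑ x ∈ block blk i, ∑ y, π x * P x y * (f x - f y) ^ 2
      = ∑ x ∈ block blk i, ∑ j, ∑ y ∈ block blk j, π x * P x y * (f x - f y) ^ 2 :=
        sum_congr rfl fun x _ => sum_eq_sum_block blk _
    _ = ∑ j, ∑ x ∈ block blk i, ∑ y ∈ block blk j, π x * P x y * (f x - f y) ^ 2 := sum_comm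

omit [Fintype I] in
/-- The in-block sum of the restriction kernel against `(f(x) − f(y))²` is the in-block sum of `P`.
[cite: JerrumEtAl2004, §2 eq. (5) (the terms `𝓔_{π_i}(f,f)` use `P_i = P` off the diagonal)] -/
theorem sum_restrictionChain_mul_sq_sub (P : Matrix X X ℝ) (blk : X → I) (f : X → ℝ) (x : X) :
    ∑ y, restrictionChain P blk x y * (f x - f y) ^ 2
      = ∑ y ∈ block blk (blk x), P x y * (f x - f y) ^ 2 := by
  simp_rw [restrictionChain_mul_sq_sub]
  unfold block
  rw [sum_filter]
  refine sum_congr rfl fun y _ => ?_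
  split_ifs
  · rfl
  · rw [zero_mul]

omit [Fintype I] in
/-- The diagonal term is the restriction Dirichlet form: `C_{ii} = 2 π̄(i) 𝓔_{π_i}(f,f)`.
[cite: JerrumEtAl2004, §2 eq. (5) (the terms `π̄(i)𝓔_{π_i}(f,f)`)] -/
theorem crossTerm_self {π : X → ℝ} {blk : X → I} {i : I} (hM : blockMass π blk i ≠ 0)
    (P : Matrix X X ℝ) (f : X → ℝ) :
    crossTerm π P blk f i i
      = 2 * blockMass π blk i * dirichletForm (blockLaw π blk i) (restrictionChain P blk) f := by
  unfold dirichletForm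
  have h1 : ∑ x, ∑ y, blockLaw π blk i x * restrictionChain P blk x y * (f x - f y) ^ 2
      = (∑ x ∈ block blk i, π x * ∑ y ∈ block blk i, P x y * (f x - f y) ^ 2)
          / blockMass π blk i := by
    rw [← sum_blockLaw_mul]
    refine sum_congr rfl fun x _ => ?_
    by_cases hx : blk x = i
    · rw [← hx, ← sum_restrictionChain_mul_sq_sub, mul_sum]
      exact sum_congr rfl fun y _ => by ring
    · simp_rw [blockLaw_of_ne hx, zero_mul, sum_const_zero]
  rw [h1]
  unfold crossTerm
  have hc : ∀ T : ℝ, 2 * blockMass π blk i * (1 / 2 * (T / blockMass π blk i)) = T := fun T => by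
    calc 2 * blockMass π blk i * (1 / 2 * (T / blockMass π blk i))
        = blockMass π blk i / blockMass π blk i * T := by ring
      _ = T := by rw [div_self hM, one_mul]
  rw [hc]
  exact sum_congr rfl fun x _ => by rw [mul_sum]; exact sum_congr rfl fun y _ => by ring

/-- **Eq. (5): the decomposition of the Dirichlet form**,
`𝓔_π(f,f) = Σ_i π̄(i) 𝓔_{π_i}(f,f) + ½ Σ_{i ≠ j} C_{ij}`. [cite: JerrumEtAl2004, §2 eq. (5)] -/
theorem dirichletForm_decomposition {π : X → ℝ} {blk : X → I} (hM : ∀ i, blockMass π blk i ≠ 0)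
    (P : Matrix X X ℝ) (f : X → ℝ) :
    dirichletForm π P f
      = ∑ i, blockMass π blk i * dirichletForm (blockLaw π blk i) (restrictionChain P blk) f
        + (1 / 2) * ∑ i, ∑ j ∈ univ.erase i, crossTerm π P blk f i j := by
  rw [dirichletForm_eq_sum_crossTerm π P blk f]
  have h : ∀ i, ∑ j, crossTerm π P blk f i j
      = 2 * (blockMass π blk i * dirichletForm (blockLaw π blk i) (restrictionChain P blk) f)
        + ∑ j ∈ univ.erase i, crossTerm π P blk f i j := by
    intro i
    rw [sum_erase_eq_sub (mem_univ i), crossTerm_self (hM i) P f]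
    ring
  simp_rw [h, sum_add_distrib, ← mul_sum]
  ring

end Restriction

/-! ## Eqs. (7)–(13): the bound for one ordered pair of blocks (Cauchy–Schwarz) -/

/-- `(u + v + w)² ≤ 3(u² + v² + w²)`. [cite: JerrumEtAl2004, §2 eq. (7) (second inequality)] -/
private theorem sq_add_three_le (u v w : ℝ) : (u + v + w) ^ 2 ≤ 3 * (u ^ 2 + v ^ 2 + w ^ 2) := by
  nlinarith [sq_nonneg (u - v), sq_nonneg (v - w), sq_nonneg (u - w)]

/-- Cauchy–Schwarz for a non-negative weight on a product of two finite sets: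
`(ΣΣ w d)² ≤ (ΣΣ w)(ΣΣ w d²)`. [cite: JerrumEtAl2004, §2 eqs. (8)–(9) ("is seen to be
Cauchy–Schwarz") and (11)–(12)] -/
private theorem sq_sum_sum_le {α β : Type*} (s : Finset α) (t : Finset β) (w d : α → β → ℝ)
    (hw : ∀ x ∈ s, ∀ y ∈ t, 0 ≤ w x y) :
    (∑ x ∈ s, ∑ y ∈ t, w x y * d x y) ^ 2 ≤
      (∑ x ∈ s, ∑ y ∈ t, w x y) * ∑ x ∈ s, ∑ y ∈ t, w x y * d x y ^ 2 := by
  have h : (∑ p ∈ s ×ˢ t, w p.1 p.2 * d p.1 p.2) ^ 2 ≤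
      (∑ p ∈ s ×ˢ t, w p.1 p.2) * ∑ p ∈ s ×ˢ t, w p.1 p.2 * d p.1 p.2 ^ 2 := by
    refine sum_sq_le_sum_mul_sum_of_sq_le_mul _ (fun p hp => ?_) (fun p hp => ?_) (fun p hp => ?_)
    · exact hw _ (mem_product.mp hp).1 _ (mem_product.mp hp).2
    · exact mul_nonneg (hw _ (mem_product.mp hp).1 _ (mem_product.mp hp).2) (sq_nonneg _)
    · exact le_of_eq (by ring)
  simpa only [sum_product] using h

/-- The three-term bound for one pair of index sets and a non-negative weight `w` on `s × t`:
`(ΣΣ w)(a − b)² ≤ 3[ΣΣ w (g x − a)² + ΣΣ w (g x − h y)² + ΣΣ w (h y − b)²]` — write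
`a − b = (a − g x) + (g x − h y) + (h y − b)`, average against `w`, and use Cauchy–Schwarz three times.
[cite: JerrumEtAl2004, §2 eqs. (7)–(12)] -/
private theorem sum_mul_sq_sub_le_three {α β : Type*} (s : Finset α) (t : Finset β)
    (w : α → β → ℝ) (hw : ∀ x ∈ s, ∀ y ∈ t, 0 ≤ w x y) (g : α → ℝ) (h : β → ℝ) (a b : ℝ) :
    (∑ x ∈ s, ∑ y ∈ t, w x y) * (a - b) ^ 2 ≤
      3 * ((∑ x ∈ s, ∑ y ∈ t, w x y * (g x - a) ^ 2)
        + (∑ x ∈ s, ∑ y ∈ t, w x y * (g x - h y) ^ 2)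
        + ∑ x ∈ s, ∑ y ∈ t, w x y * (h y - b) ^ 2) := by
  set F := ∑ x ∈ s, ∑ y ∈ t, w x y with hF
  set U := ∑ x ∈ s, ∑ y ∈ t, w x y * (g x - a) ^ 2 with hU
  set C := ∑ x ∈ s, ∑ y ∈ t, w x y * (g x - h y) ^ 2 with hC
  set V := ∑ x ∈ s, ∑ y ∈ t, w x y * (h y - b) ^ 2 with hV
  set T₁ := ∑ x ∈ s, ∑ y ∈ t, w x y * (a - g x) with hT₁
  set T₂ := ∑ x ∈ s, ∑ y ∈ t, w x y * (g x - h y) with hT₂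
  set T₃ := ∑ x ∈ s, ∑ y ∈ t, w x y * (h y - b) with hT₃
  have hF0 : 0 ≤ F := sum_nonneg fun x hx => sum_nonneg fun y hy => hw x hx y hy
  have hU0 : 0 ≤ U := sum_nonneg fun x hx => sum_nonneg fun y hy =>
    mul_nonneg (hw x hx y hy) (sq_nonneg _)
  have hC0 : 0 ≤ C := sum_nonneg fun x hx => sum_nonneg fun y hy =>
    mul_nonneg (hw x hx y hy) (sq_nonneg _)
  have hV0 : 0 ≤ V := sum_nonneg fun x hx => sum_nonneg fun y hy =>
    mul_nonneg (hw x hx y hy) (sq_nonneg _)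
  have hsum : F * (a - b) = T₁ + T₂ + T₃ := by
    rw [hF, hT₁, hT₂, hT₃, sum_mul, ← sum_add_distrib, ← sum_add_distrib]
    refine sum_congr rfl fun x _ => ?_
    rw [sum_mul, ← sum_add_distrib, ← sum_add_distrib]
    exact sum_congr rfl fun y _ => by ring
  have h1 : T₁ ^ 2 ≤ F * U := by
    have h : (∑ x ∈ s, ∑ y ∈ t, w x y * (a - g x)) ^ 2
        ≤ F * ∑ x ∈ s, ∑ y ∈ t, w x y * (a - g x) ^ 2 := sq_sum_sum_le s t w (fun x _ => a - g x) hw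
    have hU' : ∑ x ∈ s, ∑ y ∈ t, w x y * (a - g x) ^ 2 = U := by
      rw [hU]
      exact sum_congr rfl fun x _ => sum_congr rfl fun y _ => by ring
    rw [hU'] at h
    exact h
  have h2 : T₂ ^ 2 ≤ F * C := sq_sum_sum_le s t w (fun x y => g x - h y) hw
  have h3 : T₃ ^ 2 ≤ F * V := sq_sum_sum_le s t w (fun _ y => h y - b) hw
  have h3pt := sq_add_three_le T₁ T₂ T₃
  rcases hF0.eq_or_lt with hF0' | hFpos
  · rw [← hF0', zero_mul]
    linarith
  · have hsq : (F * (a - b)) ^ 2 = (T₁ + T₂ + T₃) ^ 2 := by rw [hsum]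
    have key : F * (F * (a - b) ^ 2) ≤ F * (3 * (U + C + V)) := by nlinarith
    exact le_of_mul_le_mul_left key hFpos

omit [Fintype I] in
/-- **Eqs. (7)–(13) for one ordered pair of blocks**: for `π ≥ 0`, `P ≥ 0` and ANY constants `a, b`,
`π̄(i)P̄(i,j)(a − b)² ≤ 3[Σ_{x∈Ω_i,y∈Ω_j} π(x)P(x,y)(f(x) − a)² + C_{ij} + Σ_{x∈Ω_i,y∈Ω_j} π(x)P(x,y)(f(y) − b)²]`
(the paper's `a = E_{π_i} f`, `b = E_{π_j} f`; the first and last sums are its bounds (12)–(13) for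
the `Δ₁` and `Δ₃` terms, the middle one is (8)–(10) for `Δ₂`).
[cite: JerrumEtAl2004, §2 eqs. (7)–(13)] -/
theorem blockFlow_mul_sq_sub_le {π : X → ℝ} (hπ : ∀ x, 0 ≤ π x) {P : Matrix X X ℝ}
    (hP0 : ∀ x y, 0 ≤ P x y) (blk : X → I) (f : X → ℝ) (i j : I) (a b : ℝ) :
    blockFlow π P blk i j * (a - b) ^ 2 ≤
      3 * ((∑ x ∈ block blk i, ∑ y ∈ block blk j, π x * P x y * (f x - a) ^ 2)
        + crossTerm π P blk f i j
        + ∑ x ∈ block blk i, ∑ y ∈ block blk j, π x * P x y * (f y - b) ^ 2) :=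
  sum_mul_sq_sub_le_three (block blk i) (block blk j) (fun x y => π x * P x y)
    (fun x _ y _ => mul_nonneg (hπ x) (hP0 x y)) f f a b

/-! ## Eqs. (13)–(15): summing the `Δ₁` and `Δ₃` terms — the parameter `γ` -/

/-- Summing over the other blocks and then inside them is summing over the complement of the own
block: `Σ_{j ≠ blk x} Σ_{y ∈ Ω_j} g(y) = Σ_{y ∉ Ω_{blk x}} g(y)`. [cite: JerrumEtAl2004, §2 eq. (13)
("`Σ_{j : j ≠ i} P(x, Ω_j)`")] -/
theorem sum_erase_sum_block (blk : X → I) (x : X) (g : X → ℝ) :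
    ∑ j ∈ univ.erase (blk x), ∑ y ∈ block blk j, g y
      = ∑ y ∈ univ.filter (fun y => blk y ≠ blk x), g y := by
  rw [sum_erase_eq_sub (mem_univ _), ← sum_eq_sum_block blk g, sub_eq_iff_eq_add']
  exact (sum_filter_add_sum_filter_not univ (fun y => blk y = blk x) g).symm

omit [Fintype I] in
/-- `escapeProb P blk x ≥ 0` for `P ≥ 0`. [cite: JerrumEtAl2004, §2 eq. (3)] -/
theorem escapeProb_nonneg {P : Matrix X X ℝ} (hP0 : ∀ x y, 0 ≤ P x y) (blk : X → I) (x : X) :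
    0 ≤ escapeProb P blk x :=
  sum_nonneg fun y _ => hP0 x y

omit [Fintype I] in
/-- Every escape probability is at most `γ`. [cite: JerrumEtAl2004, §2 eq. (3) ("maximized over all
states")] -/
theorem escapeProb_le_escapeParameter (P : Matrix X X ℝ) (blk : X → I) (x : X) :
    escapeProb P blk x ≤ escapeParameter P blk :=
  le_ciSup (Set.finite_range (escapeProb P blk)).bddAbove x

omit [Fintype I] in
/-- `γ ≥ 0` (for `P ≥ 0`). [cite: JerrumEtAl2004, §2 eq. (3) ("it is clear that `γ` never exceeds
1")] -/
theorem escapeParameter_nonneg {P : Matrix X X ℝ} (hP0 : ∀ x y, 0 ≤ P x y) (blk : X → I) :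
    0 ≤ escapeParameter P blk := by
  rcases isEmpty_or_nonempty X with hX | hX
  · have h : escapeParameter P blk = 0 := Real.iSup_of_isEmpty _
    exact h.symm.le
  · obtain ⟨x⟩ := hX
    exact (escapeProb_nonneg hP0 blk x).trans (escapeProb_le_escapeParameter P blk x)

omit [Fintype I] in
/-- `γ ≤ 1` for a row-stochastic `P`. [cite: JerrumEtAl2004, §2 ("it is clear that `γ` never
exceeds 1")] -/
theorem escapeParameter_le_one {P : Matrix X X ℝ} (hP : IsRowStochastic P) (blk : X → I) :
    escapeParameter P blk ≤ 1 := by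
  rcases isEmpty_or_nonempty X with hX | hX
  · have h : escapeParameter P blk = 0 := Real.iSup_of_isEmpty _
    rw [h]
    exact zero_le_one
  · refine ciSup_le fun x => ?_
    calc escapeProb P blk x ≤ ∑ y, P x y :=
          sum_le_sum_of_subset_of_nonneg (subset_univ _) fun y _ _ => hP.1 x y
      _ = 1 := hP.2 x

/-- **The `Δ₁` sum, eqs. (13)–(14)**: for `x`'s own block average `f̄`,
`Σ_i Σ_{j ≠ i} Σ_{x∈Ω_i,y∈Ω_j} π(x)P(x,y)(f(x) − f̄(i))² = Σ_i Σ_{x∈Ω_i} π(x)(f(x) − f̄(i))² P(x, Ω∖Ω_i)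
≤ γ Σ_i π̄(i) Var_{π_i} f` whenever every escape probability is `≤ γ`.
[cite: JerrumEtAl2004, §2 eqs. (13)–(14)] -/
theorem sum_escape_term_le {π : X → ℝ} (hπ : ∀ x, 0 ≤ π x) {P : Matrix X X ℝ} {blk : X → I}
    (hM : ∀ i, blockMass π blk i ≠ 0) {γ : ℝ} (hγ : ∀ x, escapeProb P blk x ≤ γ) (f : X → ℝ) :
    ∑ i, ∑ j ∈ univ.erase i, ∑ x ∈ block blk i, ∑ y ∈ block blk j,
        π x * P x y * (f x - blockAvg π blk f i) ^ 2
      ≤ γ * ∑ i, blockMass π blk i * lawVariance (blockLaw π blk i) f := by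
  rw [mul_sum]
  refine sum_le_sum fun i _ => ?_
  rw [blockMass_mul_lawVariance_blockLaw (hM i), mul_sum, sum_comm]
  refine sum_le_sum fun x hx => ?_
  have hxi : blk x = i := mem_block.mp hx
  have h1 : ∑ j ∈ univ.erase i, ∑ y ∈ block blk j, π x * P x y * (f x - blockAvg π blk f i) ^ 2
      = π x * (f x - blockAvg π blk f i) ^ 2 * escapeProb P blk x := by
    unfold escapeProb
    rw [← hxi, mul_sum, ← sum_erase_sum_block blk x]
    exact sum_congr rfl fun j _ => sum_congr rfl fun y _ => by ring
  rw [h1]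
  have h0 : 0 ≤ π x * (f x - blockAvg π blk f i) ^ 2 := mul_nonneg (hπ x) (sq_nonneg _)
  calc π x * (f x - blockAvg π blk f i) ^ 2 * escapeProb P blk x
      ≤ π x * (f x - blockAvg π blk f i) ^ 2 * γ := mul_le_mul_of_nonneg_left (hγ x) h0
    _ = γ * (π x * (f x - blockAvg π blk f i) ^ 2) := by ring

/-- Exchanging the order of an off-diagonal double sum over blocks:
`Σ_i Σ_{j ≠ i} g(i,j) = Σ_j Σ_{i ≠ j} g(i,j)`. [cite: JerrumEtAl2004, §2 (proof of Theorem 1: "`Δ₁`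
and `Δ₃` are equal by time-reversibility" — the index swap)] -/
theorem sum_erase_comm (g : I → I → ℝ) :
    ∑ i, ∑ j ∈ univ.erase i, g i j = ∑ j, ∑ i ∈ univ.erase j, g i j := by
  have h1 : ∑ i, ∑ j ∈ univ.erase i, g i j = ∑ i, ∑ j, g i j - ∑ i, g i i := by
    rw [← sum_sub_distrib]
    exact sum_congr rfl fun i _ => sum_erase_eq_sub (mem_univ i)
  have h2 : ∑ j, ∑ i ∈ univ.erase j, g i j = ∑ j, ∑ i, g i j - ∑ j, g j j := by
    rw [← sum_sub_distrib]
    exact sum_congr rfl fun j _ => sum_erase_eq_sub (mem_univ j)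
  rw [h1, h2, sum_comm]

/-- **The `Δ₃` sum (the time reversal of (13)–(14))**: for a `π`-reversible `P`,
`Σ_i Σ_{j ≠ i} Σ_{x∈Ω_i,y∈Ω_j} π(x)P(x,y)(f(y) − f̄(j))² = Σ_j Σ_{y∈Ω_j} π(y)(f(y) − f̄(j))² P(y, Ω∖Ω_j)
≤ γ Σ_j π̄(j) Var_{π_j} f`. [cite: JerrumEtAl2004, §2 eqs. (13)–(15) with "`Δ₁` and `Δ₃` are equal by
time-reversibility"] -/
theorem sum_entry_term_le {π : X → ℝ} (hπ : ∀ x, 0 ≤ π x) {P : Matrix X X ℝ}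
    (hDB : DetailedBalance π P) {blk : X → I} (hM : ∀ i, blockMass π blk i ≠ 0) {γ : ℝ}
    (hγ : ∀ x, escapeProb P blk x ≤ γ) (f : X → ℝ) :
    ∑ i, ∑ j ∈ univ.erase i, ∑ x ∈ block blk i, ∑ y ∈ block blk j,
        π x * P x y * (f y - blockAvg π blk f j) ^ 2
      ≤ γ * ∑ i, blockMass π blk i * lawVariance (blockLaw π blk i) f := by
  -- rewrite `π(x)P(x,y) = π(y)P(y,x)`, swap the block indices and the two inner sums: this is the
  -- `Δ₁` sum for the same chain
  have h : ∑ i, ∑ j ∈ univ.erase i, ∑ x ∈ block blk i, ∑ y ∈ block blk j,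
        π x * P x y * (f y - blockAvg π blk f j) ^ 2
      = ∑ j, ∑ i ∈ univ.erase j, ∑ y ∈ block blk j, ∑ x ∈ block blk i,
        π y * P y x * (f y - blockAvg π blk f j) ^ 2 := by
    rw [sum_erase_comm]
    refine sum_congr rfl fun j _ => sum_congr rfl fun i _ => ?_
    rw [sum_comm]
    exact sum_congr rfl fun y _ => sum_congr rfl fun x _ => by rw [hDB x y]
  rw [h]
  exact sum_escape_term_le hπ hM hγ f

/-! ## Theorem 1 -/

/-- **Eq. (16): the between-block variance**, `λ̄ Var_π̄(f̄) ≤ (3/2) Σ_{i≠j} C_{ij} + 3γ Σ_i π̄(i)Var_{π_i} f`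
(the Poincaré inequality for the projection chain, the three-term bound and the two `γ`-bounds).
[cite: JerrumEtAl2004, §2 eq. (16) (before dividing by `λ̄` and using (15))] -/
theorem projection_variance_le {π : X → ℝ} (hπ : ∀ x, 0 < π x)
    {P : Matrix X X ℝ} (hP0 : ∀ x y, 0 ≤ P x y) (hDB : DetailedBalance π P) {blk : X → I}
    (hblk : Function.Surjective blk) {lamP : ℝ}
    (hproj : ∀ g : I → ℝ, lamP * lawVariance (blockMass π blk) g
      ≤ dirichletForm (blockMass π blk) (projectionChain π P blk) g)
    {γ : ℝ} (hγ : ∀ x, escapeProb P blk x ≤ γ) (f : X → ℝ) :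
    lamP * lawVariance (blockMass π blk) (blockAvg π blk f)
      ≤ (3 / 2) * ∑ i, ∑ j ∈ univ.erase i, crossTerm π P blk f i j
        + 3 * γ * ∑ i, blockMass π blk i * lawVariance (blockLaw π blk i) f := by
  have hM : ∀ i, blockMass π blk i ≠ 0 := fun i => (blockMass_pos hπ hblk i).ne'
  have hπ0 : ∀ x, 0 ≤ π x := fun x => (hπ x).le
  have h1 := hproj (blockAvg π blk f)
  rw [dirichletForm_projectionChain hM] at h1
  have h2 : ∑ i, ∑ j ∈ univ.erase i,
      blockFlow π P blk i j * (blockAvg π blk f i - blockAvg π blk f j) ^ 2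
      ≤ ∑ i, ∑ j ∈ univ.erase i, 3 *
        ((∑ x ∈ block blk i, ∑ y ∈ block blk j, π x * P x y * (f x - blockAvg π blk f i) ^ 2)
          + crossTerm π P blk f i j
          + ∑ x ∈ block blk i, ∑ y ∈ block blk j,
              π x * P x y * (f y - blockAvg π blk f j) ^ 2) :=
    sum_le_sum fun i _ => sum_le_sum fun j _ => blockFlow_mul_sq_sub_le hπ0 hP0 blk f i j _ _
  have h3 := sum_escape_term_le hπ0 hM hγ f
  have h4 := sum_entry_term_le hπ0 hDB hM hγ f
  simp_rw [mul_add, sum_add_distrib, ← mul_sum] at h2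
  linarith

/-- **THEOREM 1 (Jerrum–Son–Tetali–Vigoda).**  Consider a finite-state time-reversible Markov chain
(`π > 0`, `P ≥ 0`, `π(x)P(x,y) = π(y)P(y,x)`) decomposed into a projection chain `P̄` and restriction
chains `P_i` along a partition into nonempty blocks.  Suppose the projection chain satisfies a
Poincaré inequality with constant `λ̄ > 0` (`𝓔_π̄(g,g) ≥ λ̄ Var_π̄ g` for all `g`), the restriction
chains satisfy inequalities with uniform constant `λ_min > 0` (`𝓔_{π_i}(f,f) ≥ λ_min Var_{π_i} f`),
and every one-step escape probability is `≤ γ` (`γ ≥ 0`; e.g. `γ` = eq. (3)).  Then the original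
chain satisfies a Poincaré inequality with constant **`λ := min{λ̄/3, λ̄λ_min/(3γ + λ̄)}`**:
`𝓔_π(f,f) ≥ λ Var_π f` for every `f`. [cite: JerrumEtAl2004, §2 Theorem 1 (with proof,
eqs. (4)–(17))] -/
theorem JerrumEtAl2004_thm_1 [DecidableEq X] {π : X → ℝ} (hπ : ∀ x, 0 < π x)
    {P : Matrix X X ℝ} (hP0 : ∀ x y, 0 ≤ P x y) (hDB : DetailedBalance π P) {blk : X → I}
    (hblk : Function.Surjective blk) {lamP lamMin γ : ℝ} (hlamP : 0 < lamP) (hlamMin : 0 < lamMin)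
    (hγ0 : 0 ≤ γ)
    (hproj : ∀ g : I → ℝ, lamP * lawVariance (blockMass π blk) g
      ≤ dirichletForm (blockMass π blk) (projectionChain π P blk) g)
    (hres : ∀ i, ∀ f : X → ℝ, lamMin * lawVariance (blockLaw π blk i) f
      ≤ dirichletForm (blockLaw π blk i) (restrictionChain P blk) f)
    (hγ : ∀ x, escapeProb P blk x ≤ γ) (f : X → ℝ) :
    min (lamP / 3) (lamP * lamMin / (3 * γ + lamP)) * lawVariance π f ≤ dirichletForm π P f := by
  have hM : ∀ i, blockMass π blk i ≠ 0 := fun i => (blockMass_pos hπ hblk i).ne'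
  have hπ0 : ∀ x, 0 ≤ π x := fun x => (hπ x).le
  -- the four aggregates: A = Σ π̄(i)Var_{π_i} f, B = Var_π̄ f̄, L = Σ π̄(i)𝓔_{π_i}(f,f), Cx = Σ_{i≠j} C_ij
  set A := ∑ i, blockMass π blk i * lawVariance (blockLaw π blk i) f with hA
  set B := lawVariance (blockMass π blk) (blockAvg π blk f) with hB
  set L := ∑ i, blockMass π blk i * dirichletForm (blockLaw π blk i) (restrictionChain P blk) f
    with hL
  set Cx := ∑ i, ∑ j ∈ univ.erase i, crossTerm π P blk f i j with hCx
  have h4 : lawVariance π f = A + B := lawVariance_decomposition hM f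
  have h5 : dirichletForm π P f = L + (1 / 2) * Cx := dirichletForm_decomposition hM P f
  -- (6): λ_min A ≤ L
  have h6 : lamMin * A ≤ L := by
    rw [hA, hL, mul_sum]
    refine sum_le_sum fun i _ => ?_
    rw [mul_left_comm]
    exact mul_le_mul_of_nonneg_left (hres i f) (blockMass_nonneg hπ0 blk i)
  -- (16): λ̄ B ≤ (3/2) Cx + 3γ A
  have h16 : lamP * B ≤ (3 / 2) * Cx + 3 * γ * A := projection_variance_le hπ hP0 hDB hblk hproj hγ f
  have hA0 : 0 ≤ A := sum_nonneg fun i _ =>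
    mul_nonneg (blockMass_nonneg hπ0 blk i) (lawVariance_nonneg (blockLaw_nonneg hπ0 blk i) f)
  have hCx0 : 0 ≤ Cx := sum_nonneg fun i _ => sum_nonneg fun j _ => crossTerm_nonneg hπ0 hP0 blk f i j
  set μ := 3 * γ + lamP with hμ
  have hμpos : 0 < μ := by rw [hμ]; linarith
  set lam := min (lamP / 3) (lamP * lamMin / μ) with hlam
  have hlam1 : lam ≤ lamP / 3 := min_le_left _ _
  have hlam2 : lam * μ ≤ lamP * lamMin := (le_div_iff₀ hμpos).mp (min_le_right _ _)
  have hlam0 : 0 ≤ lam := le_min (by linarith) (div_nonneg (mul_nonneg hlamP.le hlamMin.le) hμpos.le)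
  rw [h4, h5]
  -- λ̄·(goal): λ̄ λ (A + B) ≤ λ̄ L + ½ λ̄ Cx
  have k1 : lam * (lamP * B) ≤ lam * ((3 / 2) * Cx + 3 * γ * A) := mul_le_mul_of_nonneg_left h16 hlam0
  have k2 : lam * Cx ≤ (lamP / 3) * Cx := mul_le_mul_of_nonneg_right hlam1 hCx0
  have k3 : lam * μ * A ≤ lamP * lamMin * A := mul_le_mul_of_nonneg_right hlam2 hA0
  have k4 : lamP * (lamMin * A) ≤ lamP * L := mul_le_mul_of_nonneg_left h6 hlamP.le
  have key : lamP * (lam * (A + B)) ≤ lamP * (L + 1 / 2 * Cx) := by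
    rw [hμ] at k3
    nlinarith
  exact le_of_mul_le_mul_left key hlamP

/-- **Theorem 1 with the printed parameter `γ` of eq. (3)** (`escapeParameter`, the maximal one-step
escape probability). [cite: JerrumEtAl2004, §2 Theorem 1 with eq. (3)] -/
theorem JerrumEtAl2004_thm_1_escapeParameter [DecidableEq X] {π : X → ℝ} (hπ : ∀ x, 0 < π x)
    {P : Matrix X X ℝ} (hP0 : ∀ x y, 0 ≤ P x y) (hDB : DetailedBalance π P) {blk : X → I}
    (hblk : Function.Surjective blk) {lamP lamMin : ℝ} (hlamP : 0 < lamP) (hlamMin : 0 < lamMin)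
    (hproj : ∀ g : I → ℝ, lamP * lawVariance (blockMass π blk) g
      ≤ dirichletForm (blockMass π blk) (projectionChain π P blk) g)
    (hres : ∀ i, ∀ f : X → ℝ, lamMin * lawVariance (blockLaw π blk i) f
      ≤ dirichletForm (blockLaw π blk i) (restrictionChain P blk) f) (f : X → ℝ) :
    min (lamP / 3) (lamP * lamMin / (3 * escapeParameter P blk + lamP)) * lawVariance π f
      ≤ dirichletForm π P f :=
  JerrumEtAl2004_thm_1 hπ hP0 hDB hblk hlamP hlamMin (escapeParameter_nonneg hP0 blk) hproj hres
    (escapeProb_le_escapeParameter P blk) f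

/-- On a space with two points a positive probability vector gives some set mass in `(0, ½]` (so the
constraint set `{f ⊥_π 1, ‖f‖_π = 1}` defining `Gap_R` is nonempty). [folklore] -/
private theorem exists_set_mass_le_half [Nontrivial X] {π : X → ℝ} (hπ : ∀ x, 0 < π x)
    (hπ1 : ∑ x, π x = 1) : ∃ S : Finset X, 0 < ∑ x ∈ S, π x ∧ ∑ x ∈ S, π x ≤ 1 / 2 := by
  classical
  obtain ⟨a, b, hab⟩ := exists_pair_ne X
  by_cases ha : π a ≤ 1 / 2
  · exact ⟨{a}, by rw [sum_singleton]; exact hπ a, by rw [sum_singleton]; exact ha⟩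
  · refine ⟨{b}, by rw [sum_singleton]; exact hπ b, ?_⟩
    rw [sum_singleton]
    have h2 : π a + π b ≤ ∑ x, π x := by
      rw [← sum_pair hab]
      exact sum_le_sum_of_subset_of_nonneg (subset_univ _) fun x _ _ => (hπ x).le
    rw [hπ1] at h2
    rw [not_le] at ha
    linarith

/-- **Theorem 1 for the variational spectral gap**: under the hypotheses of Theorem 1 (and
`Σ π = 1`, `|Ω| ≥ 2`), **`Gap_R(P) ≥ min{λ̄/3, λ̄λ_min/(3γ + λ̄)}`** — a Poincaré inequality with
constant `λ` is exactly the statement `λ ≤ inf{𝓔(f) : f ⊥_π 1, ‖f‖_π = 1}`.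
[cite: JerrumEtAl2004, §2 Theorem 1 with eq. (1)–(2) ("a lower bound on `λ` translates directly to
an upper bound on mixing time")] [cite: LevinPeres2017, §13.2.1 Remark 13.8] -/
theorem JerrumEtAl2004_thm_1_spectralGapR [Nontrivial X] [DecidableEq X] {π : X → ℝ}
    (hπ : ∀ x, 0 < π x) (hπ1 : ∑ x, π x = 1) {P : Matrix X X ℝ} (hP0 : ∀ x y, 0 ≤ P x y)
    (hDB : DetailedBalance π P) {blk : X → I} (hblk : Function.Surjective blk)
    {lamP lamMin γ : ℝ} (hlamP : 0 < lamP) (hlamMin : 0 < lamMin) (hγ0 : 0 ≤ γ)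
    (hproj : ∀ g : I → ℝ, lamP * lawVariance (blockMass π blk) g
      ≤ dirichletForm (blockMass π blk) (projectionChain π P blk) g)
    (hres : ∀ i, ∀ f : X → ℝ, lamMin * lawVariance (blockLaw π blk i) f
      ≤ dirichletForm (blockLaw π blk i) (restrictionChain P blk) f)
    (hγ : ∀ x, escapeProb P blk x ≤ γ) :
    min (lamP / 3) (lamP * lamMin / (3 * γ + lamP)) ≤ spectralGapR π P := by
  obtain ⟨g, hg0, hg1⟩ := exists_mean_zero_piInner_one hπ1 (exists_set_mass_le_half hπ hπ1)
  refine le_csInf ⟨_, ⟨g, ⟨hg0, hg1⟩, rfl⟩⟩ ?_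
  rintro _ ⟨f, ⟨hf0, hf1⟩, rfl⟩
  have hvar : lawVariance π f = 1 := by
    have hm : lawMean π f = 0 := hf0
    unfold lawVariance
    rw [hm]
    unfold piInner at hf1
    rw [← hf1]
    exact sum_congr rfl fun x _ => by ring
  have h := JerrumEtAl2004_thm_1 hπ hP0 hDB hblk hlamP hlamMin hγ0 hproj hres hγ f
  rw [hvar, mul_one] at h
  exact h

/-- **Theorem 1 for the spectral gap `γ(P) = 1 − λ₂`** of the reversible chain (row-stochastic `P`,
`Σ π = 1`, `|Ω| ≥ 2`): `1 − λ₂ ≥ min{λ̄/3, λ̄λ_min/(3γ + λ̄)}` (Levin–Peres–Wilmer Lemma 13.7: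
`γ = Gap_R`). [cite: JerrumEtAl2004, §2 Theorem 1 with eq. (2)] [cite: LevinPeres2017, §13.2.1
Lemma 13.7] -/
theorem JerrumEtAl2004_thm_1_spectralGap [Nontrivial X] [DecidableEq X] {π : X → ℝ}
    (hπ : ∀ x, 0 < π x) (hπ1 : ∑ x, π x = 1) {P : Matrix X X ℝ} (hP : IsRowStochastic P)
    (hDB : DetailedBalance π P) {blk : X → I} (hblk : Function.Surjective blk)
    {lamP lamMin γ : ℝ} (hlamP : 0 < lamP) (hlamMin : 0 < lamMin) (hγ0 : 0 ≤ γ)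
    (hproj : ∀ g : I → ℝ, lamP * lawVariance (blockMass π blk) g
      ≤ dirichletForm (blockMass π blk) (projectionChain π P blk) g)
    (hres : ∀ i, ∀ f : X → ℝ, lamMin * lawVariance (blockLaw π blk i) f
      ≤ dirichletForm (blockLaw π blk i) (restrictionChain P blk) f)
    (hγ : ∀ x, escapeProb P blk x ≤ γ) :
    min (lamP / 3) (lamP * lamMin / (3 * γ + lamP)) ≤ spectralGap π P := by
  rw [LevinPeres2017_lemma_13_7 hπ hπ1 hP hDB]
  exact JerrumEtAl2004_thm_1_spectralGapR hπ hπ1 hP.1 hDB hblk hlamP hlamMin hγ0 hproj hres hγ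

/-! ## Corollary 3: homogeneous exits (`γ̂ = 0`) -/

/-- **COROLLARY 3 (`γ̂ = 0`).**  If the exit mass to each other block is constant on blocks —
`P(x, Ω_j) = P(x′, Ω_j)` whenever `x, x′` lie in the same block `Ω_i ≠ Ω_j` (eq. (18) with `ε = 0`:
`π̂ʲᵢ = π_i`) — then `Δ₁ = Δ₃ = 0`, a factor `3` is saved, and Theorem 1 holds with
**`λ := min{λ̄, λ_min}`**. [cite: JerrumEtAl2004, §2 Corollary 3 (with Corollary 2 and
eqs. (18)–(22))] -/
theorem JerrumEtAl2004_cor_3 [DecidableEq X] {π : X → ℝ} (hπ : ∀ x, 0 < π x)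
    {P : Matrix X X ℝ} (hP0 : ∀ x y, 0 ≤ P x y) (hDB : DetailedBalance π P) {blk : X → I}
    (hblk : Function.Surjective blk) {lamP lamMin : ℝ}
    (hproj : ∀ g : I → ℝ, lamP * lawVariance (blockMass π blk) g
      ≤ dirichletForm (blockMass π blk) (projectionChain π P blk) g)
    (hres : ∀ i, ∀ f : X → ℝ, lamMin * lawVariance (blockLaw π blk i) f
      ≤ dirichletForm (blockLaw π blk i) (restrictionChain P blk) f)
    (hhom : ∀ x x', blk x = blk x' → ∀ j, j ≠ blk x →
      ∑ y ∈ block blk j, P x y = ∑ y ∈ block blk j, P x' y)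
    (f : X → ℝ) :
    min lamP lamMin * lawVariance π f ≤ dirichletForm π P f := by
  have hM : ∀ i, blockMass π blk i ≠ 0 := fun i => (blockMass_pos hπ hblk i).ne'
  have hπ0 : ∀ x, 0 ≤ π x := fun x => (hπ x).le
  set A := ∑ i, blockMass π blk i * lawVariance (blockLaw π blk i) f with hA
  set B := lawVariance (blockMass π blk) (blockAvg π blk f) with hB
  set L := ∑ i, blockMass π blk i * dirichletForm (blockLaw π blk i) (restrictionChain P blk) f
    with hL
  set Cx := ∑ i, ∑ j ∈ univ.erase i, crossTerm π P blk f i j with hCx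
  have h4 : lawVariance π f = A + B := lawVariance_decomposition hM f
  have h5 : dirichletForm π P f = L + (1 / 2) * Cx := dirichletForm_decomposition hM P f
  have h6 : lamMin * A ≤ L := by
    rw [hA, hL, mul_sum]
    refine sum_le_sum fun i _ => ?_
    rw [mul_left_comm]
    exact mul_le_mul_of_nonneg_left (hres i f) (blockMass_nonneg hπ0 blk i)
  -- with homogeneous exits, `F(i,j)(f̄ i − f̄ j)² ≤ C_ij` for `i ≠ j` (only the `Δ₂` term survives)
  have hpair : ∀ i, ∀ j ∈ univ.erase i,
      blockFlow π P blk i j * (blockAvg π blk f i - blockAvg π blk f j) ^ 2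
        ≤ crossTerm π P blk f i j := by
    intro i j hj
    have hji : j ≠ i := ne_of_mem_erase hj
    -- the exit mass `e := P(x, Ω_j)`, constant for `x ∈ Ω_i`
    obtain ⟨x₀, hx₀⟩ := hblk i
    set e := ∑ y ∈ block blk j, P x₀ y with he
    have hex : ∀ x ∈ block blk i, ∑ y ∈ block blk j, P x y = e := fun x hx =>
      hhom x x₀ ((mem_block.mp hx).trans hx₀.symm) j (by rw [mem_block.mp hx]; exact hji)
    -- symmetric entry mass: by reversibility `Σ_{x∈Ω_i} π(x)P(x,y) = π(y) P(y, Ω_i)`, constant `e'`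
    obtain ⟨y₀, hy₀⟩ := hblk j
    set e' := ∑ x ∈ block blk i, P y₀ x with he'
    have hey : ∀ y ∈ block blk j, ∑ x ∈ block blk i, π x * P x y = π y * e' := by
      intro y hy
      rw [he', ← hhom y y₀ ((mem_block.mp hy).trans hy₀.symm) i
        (by rw [mem_block.mp hy]; exact hji.symm), mul_sum]
      exact sum_congr rfl fun x _ => hDB x y
    -- Cauchy–Schwarz for the middle term with a := f̄ i, b := f̄ j, and the two outer terms vanish
    -- in the sense that they are not needed: expand `C_ij` around the block means.
    have hsplit : ∀ x y, (f x - f y) ^ 2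
        = (f x - blockAvg π blk f i) ^ 2 + (blockAvg π blk f i - blockAvg π blk f j) ^ 2
          + (blockAvg π blk f j - f y) ^ 2
          + 2 * (f x - blockAvg π blk f i) * (blockAvg π blk f i - blockAvg π blk f j)
          + 2 * (blockAvg π blk f i - blockAvg π blk f j) * (blockAvg π blk f j - f y)
          + 2 * ((f x - blockAvg π blk f i) * (blockAvg π blk f j - f y)) := fun x y => by ring
    -- the two "pure" cross terms integrate to zero (homogeneous exits), the mixed one is bounded by
    -- the two squares: use `2uv ≥ -(u² + v²)` — giving `C_ij ≥ F (f̄ i − f̄ j)²`.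
    have hlow : ∀ x y, π x * P x y * (f x - f y) ^ 2
        ≥ π x * P x y * ((blockAvg π blk f i - blockAvg π blk f j) ^ 2
          + 2 * (f x - blockAvg π blk f i) * (blockAvg π blk f i - blockAvg π blk f j)
          + 2 * (blockAvg π blk f i - blockAvg π blk f j) * (blockAvg π blk f j - f y)) := by
      intro x y
      have hw : 0 ≤ π x * P x y := mul_nonneg (hπ0 x) (hP0 x y)
      rw [hsplit]
      nlinarith [sq_nonneg (f x - blockAvg π blk f i + (blockAvg π blk f j - f y)),
        mul_nonneg hw (sq_nonneg (f x - blockAvg π blk f i + (blockAvg π blk f j - f y)))]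
    have hsum1 : ∑ x ∈ block blk i, ∑ y ∈ block blk j,
        π x * P x y * (2 * (f x - blockAvg π blk f i)
          * (blockAvg π blk f i - blockAvg π blk f j)) = 0 := by
      have : ∀ x ∈ block blk i, ∑ y ∈ block blk j, π x * P x y * (2 * (f x - blockAvg π blk f i)
          * (blockAvg π blk f i - blockAvg π blk f j))
          = 2 * (blockAvg π blk f i - blockAvg π blk f j) * e
            * (π x * (f x - blockAvg π blk f i)) := by
        intro x hx
        rw [← hex x hx, mul_sum, sum_mul]
        exact sum_congr rfl fun y _ => by ring
      rw [sum_congr rfl this, ← mul_sum, sum_block_mul_sub_blockAvg (hM i), mul_zero]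
    have hsum2 : ∑ x ∈ block blk i, ∑ y ∈ block blk j,
        π x * P x y * (2 * (blockAvg π blk f i - blockAvg π blk f j)
          * (blockAvg π blk f j - f y)) = 0 := by
      rw [sum_comm]
      have : ∀ y ∈ block blk j, ∑ x ∈ block blk i, π x * P x y * (2 * (blockAvg π blk f i
          - blockAvg π blk f j) * (blockAvg π blk f j - f y))
          = -(2 * (blockAvg π blk f i - blockAvg π blk f j) * e')
            * (π y * (f y - blockAvg π blk f j)) := by
        intro y hy
        rw [← sum_mul, hey y hy]
        ring
      rw [sum_congr rfl this, ← mul_sum, sum_block_mul_sub_blockAvg (hM j), mul_zero]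
    have hsum0 : ∑ x ∈ block blk i, ∑ y ∈ block blk j,
        π x * P x y * (blockAvg π blk f i - blockAvg π blk f j) ^ 2
        = blockFlow π P blk i j * (blockAvg π blk f i - blockAvg π blk f j) ^ 2 := by
      unfold blockFlow
      rw [sum_mul]
      refine sum_congr rfl fun x _ => ?_
      rw [sum_mul]
    calc blockFlow π P blk i j * (blockAvg π blk f i - blockAvg π blk f j) ^ 2
        = ∑ x ∈ block blk i, ∑ y ∈ block blk j, π x * P x y *
            ((blockAvg π blk f i - blockAvg π blk f j) ^ 2
              + 2 * (f x - blockAvg π blk f i) * (blockAvg π blk f i - blockAvg π blk f j)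
              + 2 * (blockAvg π blk f i - blockAvg π blk f j) * (blockAvg π blk f j - f y)) := by
          simp_rw [mul_add, sum_add_distrib, hsum0, hsum1, hsum2]
          ring
      _ ≤ crossTerm π P blk f i j := sum_le_sum fun x _ => sum_le_sum fun y _ => hlow x y
  -- hence `λ̄ B ≤ ½ Cx`
  have h16 : lamP * B ≤ (1 / 2) * Cx := by
    have h1 : lamP * B
        ≤ dirichletForm (blockMass π blk) (projectionChain π P blk) (blockAvg π blk f) := hproj _
    rw [dirichletForm_projectionChain hM] at h1
    have h2 : ∑ i, ∑ j ∈ univ.erase i,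
        blockFlow π P blk i j * (blockAvg π blk f i - blockAvg π blk f j) ^ 2 ≤ Cx :=
      sum_le_sum fun i _ => sum_le_sum fun j hj => hpair i j hj
    linarith
  have hA0 : 0 ≤ A := sum_nonneg fun i _ =>
    mul_nonneg (blockMass_nonneg hπ0 blk i) (lawVariance_nonneg (blockLaw_nonneg hπ0 blk i) f)
  have hCx0 : 0 ≤ Cx := sum_nonneg fun i _ => sum_nonneg fun j _ => crossTerm_nonneg hπ0 hP0 blk f i j
  have hB0 : 0 ≤ B := lawVariance_nonneg (blockMass_nonneg hπ0 blk) _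
  rw [h4, h5]
  have k1 : min lamP lamMin * A ≤ lamMin * A := mul_le_mul_of_nonneg_right (min_le_right _ _) hA0
  have k2 : min lamP lamMin * B ≤ lamP * B := mul_le_mul_of_nonneg_right (min_le_left _ _) hB0
  linarith

end Literature.Probability.MarkovChains.Decomposition

namespace Literature.Probability.MarkovChains.Decomposition

open Finset Matrix

variable {X I : Type*} [Fintype X] [Fintype I] [DecidableEq I]

/-!
## Corollary 2: the pointwise-`ε` variant (eqs. (18)–(22))

APPENDED BLOCK (LC33-g48, second filing).  Source READ: [JerrumEtAl2004] §2, the paragraph after the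
proof of Theorem 1 (eqs. (18)–(22)) and Corollary 2 with its one-line proof ("Simply use (21) in
place of (12) in the derivation of inequality (15)").  Here `π̂ʲᵢ(x) := π_i(x) P(x, Ω_j)/P̄(i,j)`
(defined whenever `P̄(i,j) > 0`), so the pointwise hypothesis (18),
`(1 − ε)π_i ≤ π̂ʲᵢ ≤ (1 + ε)π_i`, says exactly that the exit mass `P(x, Ω_j)` (`exitMass`) of every
`x ∈ Ω_i` is within a factor `1 ± ε` of its `π_i`-average `P̄(i,j)`; this is how it is typed
(`hε` below).  The modified parameter (22) is `γ̂ := 2ε max_i Σ_{j ≠ i} P̄(i,j)`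
(`modifiedEscapeParameter`).
-/

omit [Fintype I] in
/-- The exit mass `P(x, Ω_j) = Σ_{y ∈ Ω_j} P(x,y)` of a state into block `j`.
[cite: JerrumEtAl2004, §2 eq. (13) ("`P(x, Ω_j)`") and eq. (18) (via `π̂ʲᵢ(x) = π_i(x)P(x,Ω_j)/P̄(i,j)`)] -/
def exitMass (P : Matrix X X ℝ) (blk : X → I) (j : I) (x : X) : ℝ := ∑ y ∈ block blk j, P x y

omit [Fintype I] in
/-- `exitMass ≥ 0` for `P ≥ 0`. [cite: JerrumEtAl2004, §2 eq. (13)] -/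
theorem exitMass_nonneg {P : Matrix X X ℝ} (hP0 : ∀ x y, 0 ≤ P x y) (blk : X → I) (j : I) (x : X) :
    0 ≤ exitMass P blk j x :=
  sum_nonneg fun y _ => hP0 x y

omit [Fintype I] in
/-- `π̄(i)P̄(i,j) = Σ_{x ∈ Ω_i} π(x) P(x, Ω_j)`. [cite: JerrumEtAl2004, §2 eq. (13) (the identity
`Σ_{j≠i} π̂ʲᵢ(x)P̄(i,j)/π_i(x) = Σ_{j≠i} P(x,Ω_j)`)] -/
theorem blockFlow_eq_sum_exitMass (π : X → ℝ) (P : Matrix X X ℝ) (blk : X → I) (i j : I) :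
    blockFlow π P blk i j = ∑ x ∈ block blk i, π x * exitMass P blk j x := by
  unfold blockFlow exitMass
  exact sum_congr rfl fun x _ => by rw [mul_sum]

omit [Fintype I] in
/-- `P̄(i,j) ≥ 0` for `π ≥ 0`, `P ≥ 0`. [cite: JerrumEtAl2004, §2 (`P̄ : [m]² → [0,1]`)] -/
theorem projectionChain_nonneg {π : X → ℝ} (hπ : ∀ x, 0 ≤ π x) {P : Matrix X X ℝ}
    (hP0 : ∀ x y, 0 ≤ P x y) (blk : X → I) (i j : I) : 0 ≤ projectionChain π P blk i j := by
  rw [projectionChain_apply]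
  exact div_nonneg (blockFlow_nonneg hπ hP0 blk i j) (blockMass_nonneg hπ blk i)

/-- The `π_i`-average escape probability `P̄(i, [m] ∖ {i}) = Σ_{j ≠ i} P̄(i,j)`.
[cite: JerrumEtAl2004, §2 eq. (22) (the inner sum `Σ_{j : j ≠ i} P̄(i,j)`)] -/
noncomputable def projectionEscape (π : X → ℝ) (P : Matrix X X ℝ) (blk : X → I) (i : I) : ℝ :=
  ∑ j ∈ univ.erase i, projectionChain π P blk i j

/-- **`γ̂ := 2ε max_{i ∈ [m]} Σ_{j : j ≠ i} P̄(i,j)`**, the modified parameter (junk `0` for empty `[m]`).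
[cite: JerrumEtAl2004, §2 eq. (22)] -/
noncomputable def modifiedEscapeParameter (π : X → ℝ) (P : Matrix X X ℝ) (blk : X → I) (ε : ℝ) : ℝ :=
  2 * ε * ⨆ i, projectionEscape π P blk i

/-- `projectionEscape ≥ 0` (for `π ≥ 0`, `P ≥ 0`). [cite: JerrumEtAl2004, §2 eq. (22)] -/
theorem projectionEscape_nonneg {π : X → ℝ} (hπ : ∀ x, 0 ≤ π x) {P : Matrix X X ℝ}
    (hP0 : ∀ x y, 0 ≤ P x y) (blk : X → I) (i : I) : 0 ≤ projectionEscape π P blk i :=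
  sum_nonneg fun j _ => projectionChain_nonneg hπ hP0 blk i j

/-- `2ε Σ_{j ≠ i} P̄(i,j) ≤ γ̂` for every block `i` (`ε ≥ 0`). [cite: JerrumEtAl2004, §2 eq. (22)
("`max_{i ∈ [m]}`")] -/
theorem two_mul_projectionEscape_le {π : X → ℝ} {P : Matrix X X ℝ} {blk : X → I} {ε : ℝ}
    (hε0 : 0 ≤ ε) (i : I) :
    2 * ε * projectionEscape π P blk i ≤ modifiedEscapeParameter π P blk ε :=
  mul_le_mul_of_nonneg_left (le_ciSup (Set.finite_range (projectionEscape π P blk)).bddAbove i)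
    (by positivity)

/-- `γ̂ ≥ 0` for `ε ≥ 0` (`π ≥ 0`, `P ≥ 0`). [cite: JerrumEtAl2004, §2 eq. (22) ("`γ̂` may even be
`0`")] -/
theorem modifiedEscapeParameter_nonneg {π : X → ℝ} (hπ : ∀ x, 0 ≤ π x) {P : Matrix X X ℝ}
    (hP0 : ∀ x y, 0 ≤ P x y) (blk : X → I) {ε : ℝ} (hε0 : 0 ≤ ε) :
    0 ≤ modifiedEscapeParameter π P blk ε := by
  unfold modifiedEscapeParameter
  refine mul_nonneg (by positivity) ?_
  rcases isEmpty_or_nonempty I with hI | hI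
  · exact (Real.iSup_of_isEmpty _).symm.le
  · obtain ⟨i⟩ := hI
    exact (projectionEscape_nonneg hπ hP0 blk i).trans
      (le_ciSup (Set.finite_range (projectionEscape π P blk)).bddAbove i)

/-- The arithmetic skeleton of eqs. (7)–(16) for one pair of blocks: if `F(a − b) = T₁ + T₂ + T₃` with
`T₁² ≤ F·X`, `T₂² ≤ F·C`, `T₃² ≤ F·Y` (`F, X, C, Y ≥ 0`), then `F(a − b)² ≤ 3(X + C + Y)`.
[cite: JerrumEtAl2004, §2 eq. (7) with (10), (15) (resp. (21))] -/
private theorem three_term_bound {F a b T₁ T₂ T₃ A C B : ℝ} (hF : 0 ≤ F)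
    (hsum : F * (a - b) = T₁ + T₂ + T₃) (h1 : T₁ ^ 2 ≤ F * A) (h2 : T₂ ^ 2 ≤ F * C)
    (h3 : T₃ ^ 2 ≤ F * B) (hA : 0 ≤ A) (hC : 0 ≤ C) (hB : 0 ≤ B) :
    F * (a - b) ^ 2 ≤ 3 * (A + C + B) := by
  have h3pt := sq_add_three_le T₁ T₂ T₃
  rcases hF.eq_or_lt with hF0 | hFpos
  · rw [← hF0, zero_mul]
    linarith
  · have hsq : (F * (a - b)) ^ 2 = (T₁ + T₂ + T₃) ^ 2 := by rw [hsum]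
    have key : F * (F * (a - b) ^ 2) ≤ F * (3 * (A + C + B)) := by nlinarith
    exact le_of_mul_le_mul_left key hFpos

omit [Fintype I] in
/-- **Eqs. (19)–(21)**: under the pointwise hypothesis (18) on the pair `(i, j)` — `(1 − ε)P̄(i,j) ≤
P(x, Ω_j) ≤ (1 + ε)P̄(i,j)` for all `x ∈ Ω_i` — the `Δ₁`-numerator obeys
`(Σ_{x ∈ Ω_i} π(x)P(x,Ω_j)(E_{π_i}f − f(x)))² ≤ π̄(i)P̄(i,j) · 2ε P̄(i,j) Σ_{x∈Ω_i} π(x)(f(x) − E_{π_i}f)²`,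
i.e. `(E_{π_i} f − E_{π̂ʲᵢ} f)² ≤ 2ε Var_{π_i} f` multiplied through by `(π̄(i)P̄(i,j))²`
(eq. (11): `Var_{π̂} f = Σ π̂ (f − E_{π_i}f)² − (E_{π̂}f − E_{π_i}f)²`; (19): `≤ (1+ε)Var_{π_i} f − Var_{π̂} f`;
(20): `Var_{π̂} f ≥ (1−ε)Σ π_i (f − E_{π̂}f)² ≥ (1−ε)Var_{π_i} f`; (21): `= 2ε Var_{π_i} f`; for `ε > 1`
the cruder `(1+ε) ≤ 2ε` suffices). [cite: JerrumEtAl2004, §2 eqs. (18)–(21)] -/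
theorem sq_sum_exit_le {π : X → ℝ} (hπ : ∀ x, 0 < π x) {P : Matrix X X ℝ} (hP0 : ∀ x y, 0 ≤ P x y)
    {blk : X → I} (hblk : Function.Surjective blk) {ε : ℝ} (hε0 : 0 ≤ ε) (f : X → ℝ) (i j : I)
    (hε : 0 < projectionChain π P blk i j → ∀ x ∈ block blk i,
      (1 - ε) * projectionChain π P blk i j ≤ exitMass P blk j x ∧
        exitMass P blk j x ≤ (1 + ε) * projectionChain π P blk i j) :
    (∑ x ∈ block blk i, π x * exitMass P blk j x * (blockAvg π blk f i - f x)) ^ 2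
      ≤ blockFlow π P blk i j * (2 * ε * projectionChain π P blk i j
          * ∑ x ∈ block blk i, π x * (f x - blockAvg π blk f i) ^ 2) := by
  have hπ0 : ∀ x, 0 ≤ π x := fun x => (hπ x).le
  set M := blockMass π blk i with hM
  have hMpos : 0 < M := blockMass_pos hπ hblk i
  set F := blockFlow π P blk i j with hFeq
  set m := blockAvg π blk f i with hm
  set S := ∑ x ∈ block blk i, π x * (f x - m) ^ 2 with hS
  have hS0 : 0 ≤ S := sum_nonneg fun x _ => mul_nonneg (hπ0 x) (sq_nonneg _)
  -- the weights `u_x = π(x) P(x, Ω_j)` on `Ω_i`, total `F`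
  have hu0 : ∀ x, 0 ≤ π x * exitMass P blk j x := fun x => mul_nonneg (hπ0 x) (exitMass_nonneg hP0 blk j x)
  have hFu : F = ∑ x ∈ block blk i, π x * exitMass P blk j x := blockFlow_eq_sum_exitMass π P blk i j
  have hF0 : 0 ≤ F := by rw [hFu]; exact sum_nonneg fun x _ => hu0 x
  have hPbar : projectionChain π P blk i j = F / M := projectionChain_apply π P blk i j
  rcases hF0.eq_or_lt with hFz | hFpos
  · -- `F = 0`: every weight vanishes, the left side is `0`
    have hu : ∀ x ∈ block blk i, π x * exitMass P blk j x = 0 := fun x hx =>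
      (sum_eq_zero_iff_of_nonneg fun y _ => hu0 y).mp (hFu.symm.trans hFz.symm) x hx
    have hT : ∑ x ∈ block blk i, π x * exitMass P blk j x * (m - f x) = 0 :=
      sum_eq_zero fun x hx => by rw [hu x hx, zero_mul]
    rw [hT, ← hFz]
    simp
  · -- `F > 0`: the second moments about `m` and about the `π̂`-mean `a = A/F`
    have hPpos : 0 < projectionChain π P blk i j := by rw [hPbar]; exact div_pos hFpos hMpos
    have hεx := hε hPpos
    set A := ∑ x ∈ block blk i, π x * exitMass P blk j x * f x with hA
    set a := A / F with ha
    set Wm := ∑ x ∈ block blk i, π x * exitMass P blk j x * (f x - m) ^ 2 with hWm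
    set Wa := ∑ x ∈ block blk i, π x * exitMass P blk j x * (f x - a) ^ 2 with hWa
    have hWa0 : 0 ≤ Wa := sum_nonneg fun x _ => mul_nonneg (hu0 x) (sq_nonneg _)
    -- T₁ = F m − A = F (m − a)
    have hT : ∑ x ∈ block blk i, π x * exitMass P blk j x * (m - f x) = F * (m - a) := by
      have h1 : ∑ x ∈ block blk i, π x * exitMass P blk j x * (m - f x)
          = (∑ x ∈ block blk i, π x * exitMass P blk j x) * m - A := by
        rw [hA, sum_mul, ← sum_sub_distrib]
        exact sum_congr rfl fun x _ => by ring
      rw [h1, ← hFu, ha, mul_sub, mul_div_cancel₀ _ hFpos.ne']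
    -- parallel axis (eq. (11)): `Wm = Wa + F (a − m)²`
    have hpar : Wm = Wa + F * (a - m) ^ 2 := by
      have hlin : ∑ x ∈ block blk i, π x * exitMass P blk j x * (f x - a) = 0 := by
        have h1 : ∑ x ∈ block blk i, π x * exitMass P blk j x * (f x - a)
            = A - (∑ x ∈ block blk i, π x * exitMass P blk j x) * a := by
          rw [hA, sum_mul, ← sum_sub_distrib]
          exact sum_congr rfl fun x _ => by ring
        rw [h1, ← hFu, ha, mul_div_cancel₀ _ hFpos.ne', sub_self]
      have hx : ∀ x, π x * exitMass P blk j x * (f x - m) ^ 2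
          = π x * exitMass P blk j x * (f x - a) ^ 2
            + 2 * (a - m) * (π x * exitMass P blk j x * (f x - a))
            + (a - m) ^ 2 * (π x * exitMass P blk j x) := fun x => by ring
      rw [hWm, hWa]
      simp_rw [hx, sum_add_distrib, ← mul_sum, hlin, mul_zero, add_zero, ← hFu]
      ring
    -- upper bound (from `P(x,Ω_j) ≤ (1+ε)P̄(i,j)`): `M · Wm ≤ (1+ε) F S`
    have hup : M * Wm ≤ (1 + ε) * F * S := by
      rw [hWm, hS, mul_sum, mul_sum]
      refine sum_le_sum fun x hx => ?_
      have h2 : M * exitMass P blk j x ≤ (1 + ε) * F := by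
        have := (hεx x hx).2
        rw [hPbar] at this
        calc M * exitMass P blk j x ≤ M * ((1 + ε) * (F / M)) :=
              mul_le_mul_of_nonneg_left this hMpos.le
          _ = (1 + ε) * F := by field_simp
      have h3 : 0 ≤ π x * (f x - m) ^ 2 := mul_nonneg (hπ0 x) (sq_nonneg _)
      calc M * (π x * exitMass P blk j x * (f x - m) ^ 2)
          = (M * exitMass P blk j x) * (π x * (f x - m) ^ 2) := by ring
        _ ≤ ((1 + ε) * F) * (π x * (f x - m) ^ 2) := mul_le_mul_of_nonneg_right h2 h3
        _ = (1 + ε) * F * (π x * (f x - m) ^ 2) := by ring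
    -- lower bound (from `(1−ε)P̄(i,j) ≤ P(x,Ω_j)`): `M · Wa ≥ (1−ε) F Σ π (f − a)² ≥ (1−ε) F S` if `ε ≤ 1`
    have hSa : S ≤ ∑ x ∈ block blk i, π x * (f x - a) ^ 2 := by
      -- `Σ π (f − a)² = S + M (a − m)²` since `Σ_{Ω_i} π (f − m) = 0`
      have h0 := sum_block_mul_sub_blockAvg hMpos.ne' f
      have hx : ∀ x, π x * (f x - a) ^ 2 = π x * (f x - m) ^ 2
          + 2 * (m - a) * (π x * (f x - m)) + (m - a) ^ 2 * π x := fun x => by ring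
      simp_rw [hx, sum_add_distrib, ← mul_sum]
      rw [← hm] at h0
      rw [h0, mul_zero, add_zero, ← hS]
      have : 0 ≤ (m - a) ^ 2 * ∑ x ∈ block blk i, π x := mul_nonneg (sq_nonneg _) hMpos.le
      linarith
    have hlow : (1 - ε) * F * ∑ x ∈ block blk i, π x * (f x - a) ^ 2 ≤ M * Wa := by
      rw [hWa, mul_sum, mul_sum]
      refine sum_le_sum fun x hx => ?_
      have h2 : (1 - ε) * F ≤ M * exitMass P blk j x := by
        have := (hεx x hx).1
        rw [hPbar] at this
        calc (1 - ε) * F = M * ((1 - ε) * (F / M)) := by field_simp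
          _ ≤ M * exitMass P blk j x := mul_le_mul_of_nonneg_left this hMpos.le
      have h3 : 0 ≤ π x * (f x - a) ^ 2 := mul_nonneg (hπ0 x) (sq_nonneg _)
      calc (1 - ε) * F * (π x * (f x - a) ^ 2)
          ≤ (M * exitMass P blk j x) * (π x * (f x - a) ^ 2) := mul_le_mul_of_nonneg_right h2 h3
        _ = M * (π x * exitMass P blk j x * (f x - a) ^ 2) := by ring
    -- conclude: `T₁² = F²(m − a)² = F (Wm − Wa)` and `M (Wm − Wa) ≤ 2ε F S`
    have hMW : M * (Wm - Wa) ≤ 2 * ε * F * S := by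
      rcases le_or_gt ε 1 with hε1 | hε1
      · have h1ε : 0 ≤ (1 - ε) * F := mul_nonneg (by linarith) hFpos.le
        have := mul_le_mul_of_nonneg_left hSa h1ε
        nlinarith
      · have : M * Wa ≥ 0 := mul_nonneg hMpos.le hWa0
        have : F * S ≥ 0 := mul_nonneg hFpos.le hS0
        nlinarith
    rw [hT, hPbar]
    have hgoal : (F * (m - a)) ^ 2 * M ≤ F * (2 * ε * F * S) := by
      have : (F * (m - a)) ^ 2 = F * (Wm - Wa) := by rw [hpar]; ring
      rw [this]
      nlinarith
    rw [show F * (2 * ε * (F / M) * S) = F * (2 * ε * F * S) / M by field_simp]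
    rw [le_div_iff₀ hMpos]
    exact hgoal

/-- **COROLLARY 2 (the `ε`-pointwise variant).**  Suppose (18) holds for some `ε ≥ 0`: for every pair
of distinct blocks with `P̄(i,j) > 0` and every `x ∈ Ω_i`,
`(1 − ε) P̄(i,j) ≤ P(x, Ω_j) ≤ (1 + ε) P̄(i,j)` (equivalently `(1 − ε)π_i ≤ π̂ʲᵢ ≤ (1 + ε)π_i`
pointwise).  Let `γ̂ ≥ 2ε Σ_{j ≠ i} P̄(i,j)` for all `i` (e.g. `γ̂ := 2ε max_i Σ_{j≠i} P̄(i,j)`,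
eq. (22)).  Then Theorem 1 holds with `γ̂` replacing `γ`:
**`𝓔_π(f,f) ≥ min{λ̄/3, λ̄λ_min/(3γ̂ + λ̄)} Var_π f`**. [cite: JerrumEtAl2004, §2 Corollary 2 (with
eqs. (18)–(22); proof: "use (21) in place of (12) in the derivation of inequality (15)")] -/
theorem JerrumEtAl2004_cor_2 [DecidableEq X] {π : X → ℝ} (hπ : ∀ x, 0 < π x)
    {P : Matrix X X ℝ} (hP0 : ∀ x y, 0 ≤ P x y) (hDB : DetailedBalance π P) {blk : X → I}
    (hblk : Function.Surjective blk) {lamP lamMin ε γh : ℝ} (hlamP : 0 < lamP) (hlamMin : 0 < lamMin)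
    (hε0 : 0 ≤ ε) (hγ0 : 0 ≤ γh)
    (hproj : ∀ g : I → ℝ, lamP * lawVariance (blockMass π blk) g
      ≤ dirichletForm (blockMass π blk) (projectionChain π P blk) g)
    (hres : ∀ i, ∀ f : X → ℝ, lamMin * lawVariance (blockLaw π blk i) f
      ≤ dirichletForm (blockLaw π blk i) (restrictionChain P blk) f)
    (hε : ∀ i, ∀ j ∈ univ.erase i, 0 < projectionChain π P blk i j → ∀ x ∈ block blk i,
      (1 - ε) * projectionChain π P blk i j ≤ exitMass P blk j x ∧
        exitMass P blk j x ≤ (1 + ε) * projectionChain π P blk i j)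
    (hγ : ∀ i, 2 * ε * projectionEscape π P blk i ≤ γh) (f : X → ℝ) :
    min (lamP / 3) (lamP * lamMin / (3 * γh + lamP)) * lawVariance π f ≤ dirichletForm π P f := by
  have hM : ∀ i, blockMass π blk i ≠ 0 := fun i => (blockMass_pos hπ hblk i).ne'
  have hπ0 : ∀ x, 0 ≤ π x := fun x => (hπ x).le
  set A := ∑ i, blockMass π blk i * lawVariance (blockLaw π blk i) f with hA
  set B := lawVariance (blockMass π blk) (blockAvg π blk f) with hB
  set L := ∑ i, blockMass π blk i * dirichletForm (blockLaw π blk i) (restrictionChain P blk) f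
    with hL
  set Cx := ∑ i, ∑ j ∈ univ.erase i, crossTerm π P blk f i j with hCx
  have h4 : lawVariance π f = A + B := lawVariance_decomposition hM f
  have h5 : dirichletForm π P f = L + (1 / 2) * Cx := dirichletForm_decomposition hM P f
  have h6 : lamMin * A ≤ L := by
    rw [hA, hL, mul_sum]
    refine sum_le_sum fun i _ => ?_
    rw [mul_left_comm]
    exact mul_le_mul_of_nonneg_left (hres i f) (blockMass_nonneg hπ0 blk i)
  -- the `Δ₁`-type numerators, bounded by (21): `X i j := 2ε P̄(i,j) Σ_{Ω_i} π (f − f̄ i)²`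
  have hS : ∀ i, ∑ x ∈ block blk i, π x * (f x - blockAvg π blk f i) ^ 2
      = blockMass π blk i * lawVariance (blockLaw π blk i) f :=
    fun i => (blockMass_mul_lawVariance_blockLaw (hM i) f).symm
  -- per ordered pair: `F(i,j)(f̄ i − f̄ j)² ≤ 3 (X i j + C i j + X j i)`
  have hpair : ∀ i, ∀ j ∈ univ.erase i,
      blockFlow π P blk i j * (blockAvg π blk f i - blockAvg π blk f j) ^ 2
        ≤ 3 * (2 * ε * projectionChain π P blk i j
              * (blockMass π blk i * lawVariance (blockLaw π blk i) f)
            + crossTerm π P blk f i j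
            + 2 * ε * projectionChain π P blk j i
              * (blockMass π blk j * lawVariance (blockLaw π blk j) f)) := by
    intro i j hj
    have hji : j ≠ i := ne_of_mem_erase hj
    have hij : i ∈ univ.erase j := mem_erase.mpr ⟨hji.symm, mem_univ i⟩
    -- the three pieces of `F(f̄ i − f̄ j)`
    have hw : ∀ x ∈ block blk i, ∀ y ∈ block blk j, 0 ≤ π x * P x y :=
      fun x _ y _ => mul_nonneg (hπ0 x) (hP0 x y)
    have h1 : ∑ x ∈ block blk i, π x * exitMass P blk j x * (blockAvg π blk f i - f x)
        = ∑ x ∈ block blk i, ∑ y ∈ block blk j, π x * P x y * (blockAvg π blk f i - f x) := by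
      refine sum_congr rfl fun x _ => ?_
      unfold exitMass
      rw [mul_sum, sum_mul]
    -- third piece rewritten by reversibility: `Σ_{x∈Ω_i} π(x)P(x,y) = π(y) P(y, Ω_i)`
    have h3 : ∑ x ∈ block blk i, ∑ y ∈ block blk j, π x * P x y * (f y - blockAvg π blk f j)
        = -(∑ y ∈ block blk j, π y * exitMass P blk i y * (blockAvg π blk f j - f y)) := by
      rw [sum_comm, ← sum_neg_distrib]
      refine sum_congr rfl fun y _ => ?_
      unfold exitMass
      rw [mul_sum, sum_mul, ← sum_neg_distrib]
      exact sum_congr rfl fun x _ => by rw [hDB x y]; ring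
    have hsum : blockFlow π P blk i j * (blockAvg π blk f i - blockAvg π blk f j)
        = (∑ x ∈ block blk i, π x * exitMass P blk j x * (blockAvg π blk f i - f x))
          + (∑ x ∈ block blk i, ∑ y ∈ block blk j, π x * P x y * (f x - f y))
          + ∑ x ∈ block blk i, ∑ y ∈ block blk j, π x * P x y * (f y - blockAvg π blk f j) := by
      rw [h1]
      unfold blockFlow
      rw [sum_mul, ← sum_add_distrib, ← sum_add_distrib]
      refine sum_congr rfl fun x _ => ?_
      rw [sum_mul, ← sum_add_distrib, ← sum_add_distrib]
      exact sum_congr rfl fun y _ => by ring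
    have hT1 := sq_sum_exit_le hπ hP0 hblk hε0 f i j (hε i j hj)
    have hT3 := sq_sum_exit_le hπ hP0 hblk hε0 f j i (hε j i hij)
    -- `F(j,i) = F(i,j)` by reversibility
    have hFsymm : blockFlow π P blk j i = blockFlow π P blk i j := by
      have h := projectionChain_detailedBalance hDB hM j i
      rwa [blockMass_mul_projectionChain (hM j), blockMass_mul_projectionChain (hM i)] at h
    rw [hFsymm] at hT3
    have hT2 : (∑ x ∈ block blk i, ∑ y ∈ block blk j, π x * P x y * (f x - f y)) ^ 2
        ≤ blockFlow π P blk i j * crossTerm π P blk f i j :=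
      sq_sum_sum_le (block blk i) (block blk j) (fun x y => π x * P x y) (fun x y => f x - f y) hw
    rw [hS i] at hT1
    rw [hS j] at hT3
    have hT3' : (∑ x ∈ block blk i, ∑ y ∈ block blk j,
        π x * P x y * (f y - blockAvg π blk f j)) ^ 2
        ≤ blockFlow π P blk i j * (2 * ε * projectionChain π P blk j i
          * (blockMass π blk j * lawVariance (blockLaw π blk j) f)) := by
      rw [h3, neg_sq]
      exact hT3
    exact three_term_bound (blockFlow_nonneg hπ0 hP0 blk i j) hsum hT1 hT2 hT3'
      (mul_nonneg (mul_nonneg (mul_nonneg (by norm_num) hε0) (projectionChain_nonneg hπ0 hP0 blk i j))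
        (mul_nonneg (blockMass_nonneg hπ0 blk i) (lawVariance_nonneg (blockLaw_nonneg hπ0 blk i) f)))
      (crossTerm_nonneg hπ0 hP0 blk f i j)
      (mul_nonneg (mul_nonneg (mul_nonneg (by norm_num) hε0) (projectionChain_nonneg hπ0 hP0 blk j i))
        (mul_nonneg (blockMass_nonneg hπ0 blk j) (lawVariance_nonneg (blockLaw_nonneg hπ0 blk j) f)))
  -- summing the `Δ₁`-type bounds over `j ≠ i`: `Σ_{j≠i} 2ε P̄(i,j) π̄(i)Var_i = 2ε P̄(i,[m]∖i) π̄(i)Var_i ≤ γ̂ π̄(i)Var_i`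
  have hΔ1 : ∑ i, ∑ j ∈ univ.erase i, 2 * ε * projectionChain π P blk i j
        * (blockMass π blk i * lawVariance (blockLaw π blk i) f) ≤ γh * A := by
    rw [hA, mul_sum]
    refine sum_le_sum fun i _ => ?_
    rw [← sum_mul, ← mul_sum]
    exact mul_le_mul_of_nonneg_right (hγ i)
      (mul_nonneg (blockMass_nonneg hπ0 blk i) (lawVariance_nonneg (blockLaw_nonneg hπ0 blk i) f))
  have hΔ3 : ∑ i, ∑ j ∈ univ.erase i, 2 * ε * projectionChain π P blk j i
        * (blockMass π blk j * lawVariance (blockLaw π blk j) f) ≤ γh * A := by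
    rw [sum_erase_comm (fun i j => 2 * ε * projectionChain π P blk j i
        * (blockMass π blk j * lawVariance (blockLaw π blk j) f))]
    exact hΔ1
  -- (16) with `γ̂`: `λ̄ B ≤ (3/2) Cx + 3 γ̂ A`
  have h16 : lamP * B ≤ (3 / 2) * Cx + 3 * γh * A := by
    have h1 : lamP * B
        ≤ dirichletForm (blockMass π blk) (projectionChain π P blk) (blockAvg π blk f) := hproj _
    rw [dirichletForm_projectionChain hM] at h1
    have h2 : ∑ i, ∑ j ∈ univ.erase i,
        blockFlow π P blk i j * (blockAvg π blk f i - blockAvg π blk f j) ^ 2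
        ≤ ∑ i, ∑ j ∈ univ.erase i, 3 * (2 * ε * projectionChain π P blk i j
              * (blockMass π blk i * lawVariance (blockLaw π blk i) f)
            + crossTerm π P blk f i j
            + 2 * ε * projectionChain π P blk j i
              * (blockMass π blk j * lawVariance (blockLaw π blk j) f)) :=
      sum_le_sum fun i _ => sum_le_sum fun j hj => hpair i j hj
    simp_rw [mul_add, sum_add_distrib, ← mul_sum] at h2
    rw [← hCx] at h2
    linarith
  have hA0 : 0 ≤ A := sum_nonneg fun i _ =>
    mul_nonneg (blockMass_nonneg hπ0 blk i) (lawVariance_nonneg (blockLaw_nonneg hπ0 blk i) f)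
  have hCx0 : 0 ≤ Cx := sum_nonneg fun i _ => sum_nonneg fun j _ => crossTerm_nonneg hπ0 hP0 blk f i j
  set μ := 3 * γh + lamP with hμ
  have hμpos : 0 < μ := by rw [hμ]; linarith
  set lam := min (lamP / 3) (lamP * lamMin / μ) with hlam
  have hlam1 : lam ≤ lamP / 3 := min_le_left _ _
  have hlam2 : lam * μ ≤ lamP * lamMin := (le_div_iff₀ hμpos).mp (min_le_right _ _)
  have hlam0 : 0 ≤ lam := le_min (by linarith) (div_nonneg (mul_nonneg hlamP.le hlamMin.le) hμpos.le)
  rw [h4, h5]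
  have k1 : lam * (lamP * B) ≤ lam * ((3 / 2) * Cx + 3 * γh * A) := mul_le_mul_of_nonneg_left h16 hlam0
  have k2 : lam * Cx ≤ (lamP / 3) * Cx := mul_le_mul_of_nonneg_right hlam1 hCx0
  have k3 : lam * μ * A ≤ lamP * lamMin * A := mul_le_mul_of_nonneg_right hlam2 hA0
  have k4 : lamP * (lamMin * A) ≤ lamP * L := mul_le_mul_of_nonneg_left h6 hlamP.le
  have key : lamP * (lam * (A + B)) ≤ lamP * (L + 1 / 2 * Cx) := by
    rw [hμ] at k3
    nlinarith
  exact le_of_mul_le_mul_left key hlamP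

/-- **Corollary 2 with the printed parameter `γ̂` of eq. (22)** (`modifiedEscapeParameter`).
[cite: JerrumEtAl2004, §2 Corollary 2 with eq. (22)] -/
theorem JerrumEtAl2004_cor_2_modifiedEscapeParameter [DecidableEq X] {π : X → ℝ} (hπ : ∀ x, 0 < π x)
    {P : Matrix X X ℝ} (hP0 : ∀ x y, 0 ≤ P x y) (hDB : DetailedBalance π P) {blk : X → I}
    (hblk : Function.Surjective blk) {lamP lamMin ε : ℝ} (hlamP : 0 < lamP) (hlamMin : 0 < lamMin)
    (hε0 : 0 ≤ ε)
    (hproj : ∀ g : I → ℝ, lamP * lawVariance (blockMass π blk) g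
      ≤ dirichletForm (blockMass π blk) (projectionChain π P blk) g)
    (hres : ∀ i, ∀ f : X → ℝ, lamMin * lawVariance (blockLaw π blk i) f
      ≤ dirichletForm (blockLaw π blk i) (restrictionChain P blk) f)
    (hε : ∀ i, ∀ j ∈ univ.erase i, 0 < projectionChain π P blk i j → ∀ x ∈ block blk i,
      (1 - ε) * projectionChain π P blk i j ≤ exitMass P blk j x ∧
        exitMass P blk j x ≤ (1 + ε) * projectionChain π P blk i j) (f : X → ℝ) :
    min (lamP / 3) (lamP * lamMin / (3 * modifiedEscapeParameter π P blk ε + lamP)) * lawVariance π f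
      ≤ dirichletForm π P f :=
  JerrumEtAl2004_cor_2 hπ hP0 hDB hblk hlamP hlamMin hε0
    (modifiedEscapeParameter_nonneg (fun x => (hπ x).le) hP0 blk hε0) hproj hres hε
    (two_mul_projectionEscape_le hε0) f

end Literature.Probability.MarkovChains.Decomposition

namespace Literature.Probability.MarkovChains.Decomposition

open Finset Matrix

variable {X I : Type*} [Fintype X] [Fintype I] [DecidableEq I]

/-!
## Theorem 1 with the OPTIMAL Poincaré constants: the variational gaps of `P̄` and of the `P_i`

APPENDED BLOCK (LC33-g48, third filing).  [JerrumEtAl2004] §2 calls `λ` in (1) "the corresponding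
Poincaré constant" and §3 (after eq. (35)) adds "[Strictly speaking, we must interpret `λ_min` here as
the minimum over the optimal Poincaré constants (i.e., spectral gaps) of the `m` restriction Markov
chains]".  The optimal constant in `𝓔_μ(f,f) ≥ λ Var_μ f` is the variational gap
`Gap_R(μ, Q) = inf{𝓔(g) : g ⊥_μ 1, ‖g‖_μ = 1}` (`spectralGapR` of `PeskunOrdering.lean`; for a
reversible chain it is `γ = 1 − λ₂`, Levin–Peres–Wilmer Lemma 13.7).  This block removes the free
constants `λ̄`, `λ_min` from Theorem 1: with `Ḡ := Gap_R(π̄, P̄)` and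
`G_min := min_i Gap_R(π_i, P_i)` (each restriction gap typed on `Ω` with the law `π_i` supported on
`Ω_i` — the values of a test function off `Ω_i` are invisible to both the constraint and the energy, so
this is the gap of the chain `P_i` on `Ω_i`), **`Gap_R(π, P) ≥ min{Ḡ/3, Ḡ·G_min/(3γ + Ḡ)}`**.
-/

omit [Fintype I] [DecidableEq I] in
/-- The variational gap is a Poincaré constant: `Gap_R(μ,Q) · Var_μ f ≤ 𝓔_μ(Q; f)` for every `f`,
for a probability vector `μ ≥ 0` and `Q ≥ 0` (Remark 13.8 of Levin–Peres–Wilmer in product form; the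
case `Var_μ f = 0` is trivial). [cite: LevinPeres2017, §13.2.1 Remark 13.8]
[cite: JerrumEtAl2004, §2 eq. (1) ("with `λ > 0` being the corresponding Poincaré constant")] -/
theorem spectralGapR_mul_lawVariance_le {μ : X → ℝ} (hμ0 : ∀ x, 0 ≤ μ x) (hμ1 : ∑ x, μ x = 1)
    {Q : Matrix X X ℝ} (hQ0 : ∀ x y, 0 ≤ Q x y) (f : X → ℝ) :
    spectralGapR μ Q * lawVariance μ f ≤ dirichletForm μ Q f := by
  rcases (lawVariance_nonneg hμ0 f).eq_or_lt with hV | hV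
  · rw [← hV, mul_zero]
    exact dirichletForm_nonneg hμ0 hQ0 f
  · exact (le_div_iff₀ hV).mp (spectralGapR_le_dirichletForm_div_lawVariance hμ0 hμ1 hQ0 hV)

/-- `Σ_i π̄(i) = 1` for a probability vector `π`. [cite: JerrumEtAl2004, §2 (`π̄` "is to be
considered as a probability distribution on `[m]`")] -/
theorem sum_blockMass_eq_one {π : X → ℝ} (hπ1 : ∑ x, π x = 1) (blk : X → I) :
    ∑ i, blockMass π blk i = 1 := by
  rw [sum_blockMass, hπ1]

/-- For the projection chain of a reversible chain on at least two nonempty blocks, the variational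
gap IS the spectral gap `1 − λ₂(P̄)` (Levin–Peres–Wilmer Lemma 13.7 applied to `P̄`, which is
stochastic, `π̄`-reversible, `π̄ > 0`). [cite: JerrumEtAl2004, §2 ("Since the original Markov chain is
time-reversible, so is the projection chain")] [cite: LevinPeres2017, §13.2.1 Lemma 13.7] -/
theorem spectralGap_projectionChain [Nontrivial I] {π : X → ℝ} (hπ : ∀ x, 0 < π x)
    (hπ1 : ∑ x, π x = 1) {P : Matrix X X ℝ} (hP : IsRowStochastic P) (hDB : DetailedBalance π P)
    {blk : X → I} (hblk : Function.Surjective blk) :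
    spectralGap (blockMass π blk) (projectionChain π P blk)
      = spectralGapR (blockMass π blk) (projectionChain π P blk) :=
  LevinPeres2017_lemma_13_7 (blockMass_pos hπ hblk) (sum_blockMass_eq_one hπ1 blk)
    (projectionChain_isRowStochastic hπ hP hblk)
    (projectionChain_detailedBalance hDB fun i => (blockMass_pos hπ hblk i).ne')

/-- **THEOREM 1 WITH THE OPTIMAL CONSTANTS (spectral gaps of the pieces).**  For a finite reversible
chain (`π > 0` a probability vector, `P` stochastic and `π`-reversible, `|Ω| ≥ 2`) decomposed along a
partition into nonempty blocks, with `Ḡ := Gap_R(π̄, P̄)` the variational gap of the projection chain,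
`G_min := min_i Gap_R(π_i, P_i)` that of the restriction chains, and `γ ≥ 0` a bound on the one-step
escape probabilities (e.g. eq. (3)):
**`Gap_R(π, P) ≥ min{Ḡ/3, Ḡ·G_min/(3γ + Ḡ)}`** (and `Gap_R(π,P) = 1 − λ₂(P)` by Lemma 13.7,
`JerrumEtAl2004_thm_1_spectralGap`).  When `Ḡ = 0` or `G_min = 0` the bound is the trivial `0`.
[cite: JerrumEtAl2004, §2 Theorem 1 with eq. (1)–(2) and §3 ("[Strictly speaking, we must interpret
`λ_min` here as the minimum over the optimal Poincaré constants (i.e., spectral gaps) of the `m`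
restriction Markov chains]")] [cite: LevinPeres2017, §13.2.1 Lemma 13.7, Remark 13.8] -/
theorem JerrumEtAl2004_thm_1_gaps [Nontrivial X] [DecidableEq X] {π : X → ℝ} (hπ : ∀ x, 0 < π x)
    (hπ1 : ∑ x, π x = 1) {P : Matrix X X ℝ} (hP : IsRowStochastic P) (hDB : DetailedBalance π P)
    {blk : X → I} (hblk : Function.Surjective blk) {γ : ℝ} (hγ0 : 0 ≤ γ)
    (hγ : ∀ x, escapeProb P blk x ≤ γ) :
    min (spectralGapR (blockMass π blk) (projectionChain π P blk) / 3)
        (spectralGapR (blockMass π blk) (projectionChain π P blk)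
          * (⨅ i, spectralGapR (blockLaw π blk i) (restrictionChain P blk))
          / (3 * γ + spectralGapR (blockMass π blk) (projectionChain π P blk)))
      ≤ spectralGapR π P := by
  have hπ0 : ∀ x, 0 ≤ π x := fun x => (hπ x).le
  have hM : ∀ i, blockMass π blk i ≠ 0 := fun i => (blockMass_pos hπ hblk i).ne'
  obtain ⟨x₀, -⟩ := exists_pair_ne X
  haveI : Nonempty I := ⟨blk x₀⟩
  set G := spectralGapR (blockMass π blk) (projectionChain π P blk) with hG
  set Gm := ⨅ i, spectralGapR (blockLaw π blk i) (restrictionChain P blk) with hGm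
  have hR0 : ∀ x y, 0 ≤ restrictionChain P blk x y := (restrictionChain_isRowStochastic hP blk).1
  have hG0 : 0 ≤ G :=
    spectralGapR_nonneg (blockMass_nonneg hπ0 blk) (projectionChain_nonneg hπ0 hP.1 blk)
  have hGi0 : ∀ i, 0 ≤ spectralGapR (blockLaw π blk i) (restrictionChain P blk) := fun i =>
    spectralGapR_nonneg (blockLaw_nonneg hπ0 blk i) hR0
  have hbdd : BddBelow (Set.range fun i => spectralGapR (blockLaw π blk i) (restrictionChain P blk)) :=
    (Set.finite_range _).bddBelow
  have hGm0 : 0 ≤ Gm := le_ciInf fun i => hGi0 i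
  have hGmle : ∀ i, Gm ≤ spectralGapR (blockLaw π blk i) (restrictionChain P blk) := fun i =>
    ciInf_le hbdd i
  have hgap0 : 0 ≤ spectralGapR π P := spectralGapR_nonneg hπ0 hP.1
  -- degenerate cases: the constant is `≤ 0`
  rcases hG0.eq_or_lt with hGz | hGpos
  · rw [← hGz]
    simp only [zero_div, zero_mul, min_self]
    exact hgap0
  rcases hGm0.eq_or_lt with hGmz | hGmpos
  · rw [← hGmz, mul_zero, zero_div]
    exact (min_le_right _ _).trans hgap0
  -- main case: Theorem 1 with `λ̄ := Ḡ`, `λ_min := G_min`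
  refine JerrumEtAl2004_thm_1_spectralGapR hπ hπ1 hP.1 hDB hblk hGpos hGmpos hγ0 ?_ ?_ hγ
  · intro g
    exact spectralGapR_mul_lawVariance_le (blockMass_nonneg hπ0 blk) (sum_blockMass_eq_one hπ1 blk)
      (projectionChain_nonneg hπ0 hP.1 blk) g
  · intro i f
    calc Gm * lawVariance (blockLaw π blk i) f
        ≤ spectralGapR (blockLaw π blk i) (restrictionChain P blk) * lawVariance (blockLaw π blk i) f :=
          mul_le_mul_of_nonneg_right (hGmle i) (lawVariance_nonneg (blockLaw_nonneg hπ0 blk i) f)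
      _ ≤ dirichletForm (blockLaw π blk i) (restrictionChain P blk) f :=
          spectralGapR_mul_lawVariance_le (blockLaw_nonneg hπ0 blk i) (sum_blockLaw (hM i)) hR0 f

/-- The same with the printed `γ` of eq. (3). [cite: JerrumEtAl2004, §2 Theorem 1 with eq. (3)] -/
theorem JerrumEtAl2004_thm_1_gaps_escapeParameter [Nontrivial X] [DecidableEq X] {π : X → ℝ}
    (hπ : ∀ x, 0 < π x) (hπ1 : ∑ x, π x = 1) {P : Matrix X X ℝ} (hP : IsRowStochastic P)
    (hDB : DetailedBalance π P) {blk : X → I} (hblk : Function.Surjective blk) :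
    min (spectralGapR (blockMass π blk) (projectionChain π P blk) / 3)
        (spectralGapR (blockMass π blk) (projectionChain π P blk)
          * (⨅ i, spectralGapR (blockLaw π blk i) (restrictionChain P blk))
          / (3 * escapeParameter P blk + spectralGapR (blockMass π blk) (projectionChain π P blk)))
      ≤ spectralGapR π P :=
  JerrumEtAl2004_thm_1_gaps hπ hπ1 hP hDB hblk (escapeParameter_nonneg hP.1 blk)
    (escapeProb_le_escapeParameter P blk)

end Literature.Probability.MarkovChains.Decomposition
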